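import Mathlib
import Literature.NumberTheory.LFunctions.BuiHall.Sign1
import HarnessLib

/-!
# Bui–Hall sign conjecture, hub-kernel port — the analytic leg (box `BuiHallSign.lean`), part 2/3

LINE 1 — LABEL: RH-FREE (a theorem about explicit polynomial integrals — the sign of the main-term coefficient
`HARDY(k,ℓ,m,n)` of the mixed fourth moments of the derivatives of Hardy's `Z`); LADDER-RH materiality NIL
(director-rh 2026-08-27); class RECORDS → PAPERS. Nothing here bears on the truth of RH.

PROVENANCE (byte level). Hub-kernel PORT of the box file `run/shared/lean/archive/2001-boxes/rh/summits/rh-w-lgap/free/y2/lean/BuiHallSign.lean` (sha256/16 `560d5e447cc8ed51`),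
itself GENERATED by `run/shared/lean/archive/2001-boxes/rh/summits/rh-w-lgap/free/y2/lean/gen/gen_bh.py` (sha256/16 `80cee6d9d1ddbd5e`; `--assemble` from cells.json sha256
`03ab224ad42ef36c…` + certs.jsonl sha256 `240e612880cce7bc…`, run rh-lgapy2-bh-2, and the hand-written parts `gen/part_*.lean`).
This module = part 2 of 3 of the box file's body (sections: Proposition `11family` (= Prop. 6) — part 2: the monomial mixture (Fubini instea; eq. (prims): the closed forms `nuSumLe`, `nuDiffGe`, `nuRect` ARE the polygon in; Lemma QI — part 1: the truncated profile `f̃_x`, `F̃ = f̃_x ∗ f̃_y`, its window ; Lemma QI — part 2: `∫_{v-u}^{1-u} F̃ + ∫_{u+v}^{1+u} F̃ = Lam u v x y` (Lemma QI; The mixture (Section 4.1, tex 187–189) — part 1: `f_c = ∫ f̃_r dm_c(r)` inside t; The mixture — part 2: window integration, exchange with `dm_c ⊗ dm_d`, and `Mixt; Theorem structure, Step 3 (tex 116–118): the layer-cake/scaling identity; Theorem structure, Step 1 (tex 99–107): `HARDY` through the oriented integrals `; Theorem structure, Step 2 (2f): the fibre length is `½ − ‖ξ‖_∞` EXACTLY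 on the h; Theorem structure, Step 2 (2e): the fibre integral, and a support/range lemma (s; Theorem structure, Step 3 (2h): layer cake `(½ − ‖ξ‖∞)₊ = ∫₀^{½} 1[‖ξ‖∞ ≤ ρ] dρ`; Theorem structure, Step 3 assembled: `∫_{[-½,½]³} ξ^k (½ − ‖ξ‖∞)₊ = ∫₀^{½} cubeI; Theorem structure, Step 2 pieces: (2b) `J` as a window integral over the fixed s).  Port edits ONLY: namespace `Literature.NumberTheory.LFunctions.BuiHall` (+ a `Part…` sub-namespace for the generated
decision-tree names), the shared definitions block replaced by `import Literature.NumberTheory.LFunctions.BuiHall.Defs`, module split to the hub's file-size cap,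
docstrings/provenance tags added; statements and proof scripts are verbatim unless a docstring says otherwise.

CONTEXT (box paper = the 2001-box write-up `work/paper-v3-d979a68f.tex`, its Theorem 13 = the Bui–Hall sign conjecture
[BuiHall2023, §1 Conjecture 1]; fidelity notes `FIDELITY-BH.md` in the box): the paper's objects (HARDY = Bui–Hall's quadruple
integral verbatim, `M` via `∫_Q`, `h_{c,d}`, `H_{c,d}`, `F_{c,d}`, `T`), the residue rule of Section 3, Lemma C, Corollary signs (a),
Proposition oddodd's analytic step, the chart identity eq. (Tcd), Proposition 11family's implication, Section 4.1 (eq. (Lcd), the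
mixture, Lemma QI, eq. (prims)) and Theorem structure are PROVED across the modules `Sign1…`; the master inequality `Λ ≤ 0` on `D`
comes from the `Certs…`/`Master…` modules; everything is assembled in module `Final` (`theorem_BH_sign`, hypothesis-free).
Intermediate statements of the box paper are kept as named Props (`StructureThm`, `ChartIdentity`, …) exactly as in the box file and
each is PROVED in these modules (`structureThm_holds`, `chartIdentity_holds`, `allEvenPos_holds`, `oddOddCore_holds`,
`elevenCore_holds`, `lemmaC_conclusions`, `mixture_holds`, `reduction_of_mixture`); none is left as a hypothesis.
-/

set_option maxRecDepth 4000
set_option maxHeartbeats 2000000 -- generated certificate identities (`grind`) and long `linarith` calls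
set_option linter.unusedVariables false -- generated cell signatures are uniform; a given certificate uses only some hypotheses
set_option linter.unusedSimpArgs false -- the generated `simp only [...]` unfolding lists are uniform across cells
set_option linter.unusedTactic false -- idem (generated scripts)
set_option linter.unreachableTactic false -- idem (generated scripts)
set_option linter.style.longLine false -- generated one-line polynomial identities
set_option linter.style.longFile 0
set_option Elab.async false

noncomputable section

namespace Literature.NumberTheory.LFunctions.BuiHall

open _root_.MeasureTheory intervalIntegral _root_.Set _root_.Filter

/-! ## Proposition `11family` (= Prop. 6) — part 2: the monomial mixture (Fubini instead of by-parts) and `T > 0`: `ElevenCore` -/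

section eleven2
variable (c d : ℕ)

/-- weight of `dm_{n+1}`: `2(n+1) r^{2n+1}` [folklore] -/
noncomputable def wN (n : ℕ) (r : ℝ) : ℝ := 2 * ((n:ℝ) + 1) * r ^ (2 * n + 1)

/-- Auxiliary lemma `wN_nonneg` of the Bui–Hall sign-conjecture leg (Proposition `11family` (= Prop. 6) — part 2: the monomial mixture (Fubini instead of by-parts) and `T > 0`:…); statement as displayed, box port verbatim. [cite: BuiHall2023, §1 Conjecture 1 — a step of THIS TREE's proof of it (box write-up paper-v3-d979a68f Proposition `11family` (= Prop. 6) — part 2: the monomial mixture (Fub); the cited paper states the conjecture and the proof is ours] -/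
theorem wN_nonneg (n : ℕ) {r : ℝ} (hr : 0 ≤ r) : 0 ≤ wN n r := by unfold wN; positivity
/-- Auxiliary lemma `wN_pos` of the Bui–Hall sign-conjecture leg (Proposition `11family` (= Prop. 6) — part 2: the monomial mixture (Fubini instead of by-parts) and `T > 0`:…); statement as displayed, box port verbatim. [cite: BuiHall2023, §1 Conjecture 1 — a step of THIS TREE's proof of it (box write-up paper-v3-d979a68f Proposition `11family` (= Prop. 6) — part 2: the monomial mixture (Fub); the cited paper states the conjecture and the proof is ours] -/
theorem wN_pos (n : ℕ) {r : ℝ} (hr : 0 < r) : 0 < wN n r := by unfold wN; positivity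
/-- Auxiliary lemma `wN_continuous` of the Bui–Hall sign-conjecture leg (Proposition `11family` (= Prop. 6) — part 2: the monomial mixture (Fubini instead of by-parts) and `T > 0`:…); statement as displayed, box port verbatim. [cite: BuiHall2023, §1 Conjecture 1 — a step of THIS TREE's proof of it (box write-up paper-v3-d979a68f Proposition `11family` (= Prop. 6) — part 2: the monomial mixture (Fub); the cited paper states the conjecture and the proof is ours] -/
theorem wN_continuous (n : ℕ) : Continuous (wN n) := by unfold wN; fun_prop

/-- `u^{2(n+1)} = ∫_0^1 1[x ≤ u] 2(n+1) x^{2n+1} dx` for `u ∈ [0,1]` [cite: BuiHall2023, §1 Conjecture 1 — a step of THIS TREE's proof of it (box write-up paper-v3-d979a68f Proposition `11family` (= Prop. 6) — part 2: the monomial mixture (Fub); the cited paper states the conjecture and the proof is ours] -/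
theorem pow_as_integral (n : ℕ) {u : ℝ} (hu : u ∈ Icc (0:ℝ) 1) :
    u ^ (2 * (n + 1)) = ∫ x in (0:ℝ)..1, (if x ≤ u then wN n x else 0) := by
  have e : (fun x => if x ≤ u then wN n x else 0) = Set.indicator {x | x ≤ u} (wN n) := by
    ext x; simp only [Set.indicator_apply, mem_setOf_eq]
  rw [e, intervalIntegral.integral_indicator hu]
  unfold wN
  rw [intervalIntegral.integral_const_mul, integral_pow]
  have : (2 * (n:ℝ) + 1 + 1) ≠ 0 := by positivity
  field_simp
  push_cast
  ring

/-- Auxiliary lemma `integrableOn_ite_sq` of the Bui–Hall sign-conjecture leg (Proposition `11family` (= Prop. 6) — part 2: the monomial mixture (Fubini instead of by-parts) and `T > 0`:…); statement as displayed, box port verbatim. [cite: BuiHall2023, §1 Conjecture 1 — a step of THIS TREE's proof of it (box write-up paper-v3-d979a68f Proposition `11family` (= Prop. 6) — part 2: the monomial mixture (Fub); the cited paper states the conjecture and the proof is ours] -/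
theorem integrableOn_ite_sq {P : ℝ × ℝ → Prop} [DecidablePred P] (hP : MeasurableSet {x | P x}) {f : ℝ × ℝ → ℝ}
    (hf : Continuous f) (a b : ℝ) : IntegrableOn (fun x => if P x then f x else 0) (Set.uIoc a b ×ˢ Set.uIoc a b) := by
  have heq : (fun x => if P x then f x else 0) = Set.indicator {x | P x} f := by
    ext x; simp only [Set.indicator_apply, mem_setOf_eq]
  rw [heq]
  apply IntegrableOn.indicator _ hP
  have hK : IsCompact (Set.uIcc a b ×ˢ Set.uIcc a b) := isCompact_uIcc.prod isCompact_uIcc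
  exact (hf.continuousOn.integrableOn_compact hK).mono_set (Set.prod_mono Set.uIoc_subset_uIcc Set.uIoc_subset_uIcc)

/-- step A: `∫_0^1 v^{2(m+1)} q(u,v) dv = ∫_0^1 2(m+1) y^{2m+1} g_y(u) dy` [cite: BuiHall2023, §1 Conjecture 1 — a step of THIS TREE's proof of it (box write-up paper-v3-d979a68f Proposition `11family` (= Prop. 6) — part 2: the monomial mixture (Fub); the cited paper states the conjecture and the proof is ours] -/
theorem eleven_stepA (m : ℕ) (u : ℝ) :
    ∫ v in (0:ℝ)..1, v ^ (2 * (m + 1)) * qK c d u v = ∫ y in (0:ℝ)..1, wN m y * gInner c d y u := by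
  have hq : Continuous fun v => qK c d u v := (qK_continuous c d).comp (Continuous.prodMk_right u)
  have e1 : ∫ v in (0:ℝ)..1, v ^ (2 * (m + 1)) * qK c d u v
      = ∫ v in (0:ℝ)..1, ∫ y in (0:ℝ)..1, (if y ≤ v then wN m y * qK c d u v else 0) := by
    apply intervalIntegral.integral_congr; intro v hv
    rw [Set.uIcc_of_le zero_le_one] at hv
    simp only
    rw [pow_as_integral m hv, ← intervalIntegral.integral_mul_const]
    apply intervalIntegral.integral_congr; intro y _
    simp only; split_ifs <;> simp
  rw [e1, MeasureTheory.intervalIntegral_intervalIntegral_swap]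
  · apply intervalIntegral.integral_congr; intro y hy
    rw [Set.uIcc_of_le zero_le_one] at hy
    simp only
    have e2 : (fun v => if y ≤ v then wN m y * qK c d u v else 0)
        = Set.indicator (Ici y) (fun v => wN m y * qK c d u v) := by
      ext v; simp only [Set.indicator_apply, mem_Ici]
    rw [e2, integral_indicator_Ici hy, intervalIntegral.integral_const_mul]
    rfl
  · have : Function.uncurry (fun v y : ℝ => if y ≤ v then wN m y * qK c d u v else 0)
        = fun x : ℝ × ℝ => if x.2 ≤ x.1 then wN m x.2 * qK c d u x.1 else 0 := by
      ext ⟨v, y⟩; rfl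
    rw [this]
    apply integrableOn_ite_sq (measurableSet_le measurable_snd measurable_fst)
    exact ((wN_continuous m).comp continuous_snd).mul (hq.comp continuous_fst)

/-- step B: `∫_0^1 u^{2(n+1)} g_y(u) du = ∫_0^1 2(n+1) x^{2n+1} S̃⁰(x,y) dx` [cite: BuiHall2023, §1 Conjecture 1 — a step of THIS TREE's proof of it (box write-up paper-v3-d979a68f Proposition `11family` (= Prop. 6) — part 2: the monomial mixture (Fub); the cited paper states the conjecture and the proof is ours] -/
theorem eleven_stepB (n : ℕ) (y : ℝ) :
    ∫ u in (0:ℝ)..1, u ^ (2 * (n + 1)) * gInner c d y u = ∫ x in (0:ℝ)..1, wN n x * S0 c d x y := by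
  have hg : Continuous fun u => gInner c d y u := (gInner_continuous c d).comp (Continuous.prodMk_right y)
  have e1 : ∫ u in (0:ℝ)..1, u ^ (2 * (n + 1)) * gInner c d y u
      = ∫ u in (0:ℝ)..1, ∫ x in (0:ℝ)..1, (if x ≤ u then wN n x * gInner c d y u else 0) := by
    apply intervalIntegral.integral_congr; intro u hu
    rw [Set.uIcc_of_le zero_le_one] at hu
    simp only
    rw [pow_as_integral n hu, ← intervalIntegral.integral_mul_const]
    apply intervalIntegral.integral_congr; intro x _
    simp only; split_ifs <;> simp
  rw [e1, MeasureTheory.intervalIntegral_intervalIntegral_swap]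
  · apply intervalIntegral.integral_congr; intro x hx
    rw [Set.uIcc_of_le zero_le_one] at hx
    simp only
    have e2 : (fun u => if x ≤ u then wN n x * gInner c d y u else 0)
        = Set.indicator (Ici x) (fun u => wN n x * gInner c d y u) := by
      ext u; simp only [Set.indicator_apply, mem_Ici]
    rw [e2, integral_indicator_Ici hx, intervalIntegral.integral_const_mul]
    rfl
  · have : Function.uncurry (fun u x : ℝ => if x ≤ u then wN n x * gInner c d y u else 0)
        = fun z : ℝ × ℝ => if z.2 ≤ z.1 then wN n z.2 * gInner c d y z.1 else 0 := by
      ext ⟨u, x⟩; rfl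
    rw [this]
    apply integrableOn_ite_sq (measurableSet_le measurable_snd measurable_fst)
    exact ((wN_continuous n).comp continuous_snd).mul (hg.comp continuous_fst)

/-- `S̃⁰ > 0` near the origin [cite: BuiHall2023, §1 Conjecture 1 — a step of THIS TREE's proof of it (box write-up paper-v3-d979a68f Proposition `11family` (= Prop. 6) — part 2: the monomial mixture (Fub); the cited paper states the conjecture and the proof is ours] -/
theorem S0_pos_near_origin (hi : CondI c d) :
    ∃ δ > 0, δ ≤ 1 ∧ ∀ x y : ℝ, |x| < δ → |y| < δ → 0 < S0 c d x y := by
  have h0 : 0 < S0 c d 0 0 := S0_zero_pos c d hi le_rfl zero_lt_one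
  have hc : ContinuousAt (Function.uncurry (S0 c d)) (0, 0) := (S0_continuous c d).continuousAt
  obtain ⟨δ, hδ, h⟩ := Metric.continuousAt_iff.mp hc (S0 c d 0 0) h0
  refine ⟨min δ 1, by positivity, min_le_right _ _, fun x y hx hy => ?_⟩
  have hd : dist (x, y) ((0:ℝ), (0:ℝ)) < δ := by
    rw [Prod.dist_eq, Real.dist_eq, Real.dist_eq, sub_zero, sub_zero]
    exact max_lt (lt_of_lt_of_le hx (min_le_left _ _)) (lt_of_lt_of_le hy (min_le_left _ _))
  have := h hd
  simp only [Function.uncurry, Real.dist_eq] at this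
  have := (abs_lt.mp this).1
  linarith

/-- inner positivity: `∫_0^1 2(n+1)x^{2n+1} S̃⁰(x,y) dx > 0` for `|y| < δ`, `y ∈ [0,1]`; and `≥ 0` for all `y ∈ [0,1]` [cite: BuiHall2023, §1 Conjecture 1 — a step of THIS TREE's proof of it (box write-up paper-v3-d979a68f Proposition `11family` (= Prop. 6) — part 2: the monomial mixture (Fub); the cited paper states the conjecture and the proof is ours] -/
theorem eleven_inner_nonneg (hsp : Spade c d) (n : ℕ) {y : ℝ} (hy : y ∈ Icc (0:ℝ) 1) :
    0 ≤ ∫ x in (0:ℝ)..1, wN n x * S0 c d x y := by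
  apply intervalIntegral.integral_nonneg zero_le_one
  intro x hx
  exact mul_nonneg (wN_nonneg n hx.1) (S0_nonneg c d hsp hx hy)

/-- Auxiliary lemma `eleven_inner_pos` of the Bui–Hall sign-conjecture leg (Proposition `11family` (= Prop. 6) — part 2: the monomial mixture (Fubini instead of by-parts) and `T > 0`:…); statement as displayed, box port verbatim. [cite: BuiHall2023, §1 Conjecture 1 — a step of THIS TREE's proof of it (box write-up paper-v3-d979a68f Proposition `11family` (= Prop. 6) — part 2: the monomial mixture (Fub); the cited paper states the conjecture and the proof is ours] -/
theorem eleven_inner_pos (hsp : Spade c d) (n : ℕ) {δ : ℝ} (hδ : 0 < δ) (hδ1 : δ ≤ 1)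
    (hpos : ∀ x y : ℝ, |x| < δ → |y| < δ → 0 < S0 c d x y) {y : ℝ} (hy : y ∈ Icc (0:ℝ) 1) (hyd : |y| < δ) :
    0 < ∫ x in (0:ℝ)..1, wN n x * S0 c d x y := by
  have hS : Continuous fun x => S0 c d x y := (S0_continuous c d).comp (Continuous.prodMk_left y)
  have hg : Continuous fun x => wN n x * S0 c d x y := (wN_continuous n).mul hS
  have := intervalIntegral.integral_lt_integral_of_continuousOn_of_le_of_exists_lt zero_lt_one
    (f := fun _ => (0:ℝ)) (g := fun x => wN n x * S0 c d x y) continuousOn_const hg.continuousOn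
    (fun x hx => mul_nonneg (wN_nonneg n hx.1.le) (S0_nonneg c d hsp ⟨hx.1.le, hx.2⟩ hy))
    ⟨δ / 2, ⟨by linarith, by linarith⟩,
      mul_pos (wN_pos n (by linarith)) (hpos _ _ (by rw [abs_of_pos (by linarith)]; linarith) hyd)⟩
  simpa using this

/-- **Proposition `11family` (= Prop. 6)'s implication (i) ∧ (spade) ⇒ T_{c,d}(a,b) > 0**, proved (Fubini/mixture form of eq. (byparts)) [cite: BuiHall2023, §1 Conjecture 1 — a step of THIS TREE's proof of it (box write-up paper-v3-d979a68f Proposition `11family` (= Prop. 6) — part 2: the monomial mixture (Fub); the cited paper states the conjecture and the proof is ours] -/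
theorem elevenCore_holds : ElevenCore := by
  intro c d hi hsp a b
  rw [Tint_even_fold]
  refine mul_pos two_pos ?_
  obtain ⟨δ, hδ, hδ1, hpos⟩ := S0_pos_near_origin c d hi
  rcases a with _ | n <;> rcases b with _ | m
  · -- (0,0): T/2 = S̃⁰(0,0)
    have e : ∫ u in (0:ℝ)..1, ∫ v in (0:ℝ)..1, u ^ (2 * 0) * v ^ (2 * 0) * qK c d u v = S0 c d 0 0 := by
      unfold S0 gInner; simp
    rw [e]; exact S0_zero_pos c d hi le_rfl zero_lt_one
  · -- (0, m+1)
    have e : ∫ u in (0:ℝ)..1, ∫ v in (0:ℝ)..1, u ^ (2 * 0) * v ^ (2 * (m + 1)) * qK c d u v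
        = ∫ y in (0:ℝ)..1, wN m y * S0 c d y 0 := by
      have e1 : ∀ u, ∫ v in (0:ℝ)..1, u ^ (2 * 0) * v ^ (2 * (m + 1)) * qK c d u v
          = ∫ y in (0:ℝ)..1, wN m y * gInner c d y u := by
        intro u; rw [← eleven_stepA]; simp
      simp_rw [e1]
      rw [MeasureTheory.intervalIntegral_intervalIntegral_swap]
      · apply intervalIntegral.integral_congr; intro y _
        simp only
        rw [intervalIntegral.integral_const_mul, S0_symm]; rfl
      · have hK : IsCompact (Set.uIcc (0:ℝ) 1 ×ˢ Set.uIcc (0:ℝ) 1) := isCompact_uIcc.prod isCompact_uIcc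
        have hf : Continuous (Function.uncurry fun u y : ℝ => wN m y * gInner c d y u) := by
          have h1 := gInner_continuous c d
          have h2 := wN_continuous m
          exact (h2.comp continuous_snd).mul (h1.comp (by fun_prop : Continuous fun z : ℝ × ℝ => (z.2, z.1)))
        exact (hf.continuousOn.integrableOn_compact hK).mono_set (Set.prod_mono Set.uIoc_subset_uIcc Set.uIoc_subset_uIcc)
    rw [e]
    have hg : Continuous fun y => wN m y * S0 c d y 0 :=
      (wN_continuous m).mul ((S0_continuous c d).comp (Continuous.prodMk_left 0))
    apply intervalIntegral.intervalIntegral_pos_of_pos_on (hg.intervalIntegrable 0 1) _ zero_lt_one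
    intro y hy
    exact mul_pos (wN_pos m hy.1) (S0_zero_pos c d hi hy.1.le hy.2)
  · -- (n+1, 0)
    have e : ∫ u in (0:ℝ)..1, ∫ v in (0:ℝ)..1, u ^ (2 * (n + 1)) * v ^ (2 * 0) * qK c d u v
        = ∫ x in (0:ℝ)..1, wN n x * S0 c d x 0 := by
      rw [← eleven_stepB]
      apply intervalIntegral.integral_congr; intro u _
      simp only
      unfold gInner
      rw [← intervalIntegral.integral_const_mul]
      apply intervalIntegral.integral_congr; intro v _; simp only; ring
    rw [e]
    have hg : Continuous fun x => wN n x * S0 c d x 0 :=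
      (wN_continuous n).mul ((S0_continuous c d).comp (Continuous.prodMk_left 0))
    apply intervalIntegral.intervalIntegral_pos_of_pos_on (hg.intervalIntegrable 0 1) _ zero_lt_one
    intro x hx
    exact mul_pos (wN_pos n hx.1) (S0_zero_pos c d hi hx.1.le hx.2)
  · -- (n+1, m+1)
    have e : ∫ u in (0:ℝ)..1, ∫ v in (0:ℝ)..1, u ^ (2 * (n + 1)) * v ^ (2 * (m + 1)) * qK c d u v
        = ∫ y in (0:ℝ)..1, wN m y * ∫ x in (0:ℝ)..1, wN n x * S0 c d x y := by
      have e1 : ∀ u, ∫ v in (0:ℝ)..1, u ^ (2 * (n + 1)) * v ^ (2 * (m + 1)) * qK c d u v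
          = ∫ y in (0:ℝ)..1, u ^ (2 * (n + 1)) * (wN m y * gInner c d y u) := by
        intro u
        rw [intervalIntegral.integral_const_mul, ← eleven_stepA, ← intervalIntegral.integral_const_mul]
        apply intervalIntegral.integral_congr; intro v _; simp only; ring
      simp_rw [e1]
      rw [MeasureTheory.intervalIntegral_intervalIntegral_swap]
      · apply intervalIntegral.integral_congr; intro y _
        simp only
        rw [← eleven_stepB, ← intervalIntegral.integral_const_mul]
        apply intervalIntegral.integral_congr; intro u _; simp only; ring
      · have hK : IsCompact (Set.uIcc (0:ℝ) 1 ×ˢ Set.uIcc (0:ℝ) 1) := isCompact_uIcc.prod isCompact_uIcc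
        have hf : Continuous (Function.uncurry fun u y : ℝ => u ^ (2 * (n + 1)) * (wN m y * gInner c d y u)) := by
          have h1 := gInner_continuous c d
          have h2 := wN_continuous m
          exact (by fun_prop : Continuous fun z : ℝ × ℝ => z.1 ^ (2 * (n + 1))).mul
            ((h2.comp continuous_snd).mul (h1.comp (by fun_prop : Continuous fun z : ℝ × ℝ => (z.2, z.1))))
        exact (hf.continuousOn.integrableOn_compact hK).mono_set (Set.prod_mono Set.uIoc_subset_uIcc Set.uIoc_subset_uIcc)
    rw [e]
    have hI : Continuous fun y => ∫ x in (0:ℝ)..1, wN n x * S0 c d x y := by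
      have : Continuous (Function.uncurry fun y x : ℝ => wN n x * S0 c d x y) := by
        have h1 := S0_continuous c d
        exact ((wN_continuous n).comp continuous_snd).mul (h1.comp (by fun_prop : Continuous fun z : ℝ × ℝ => (z.2, z.1)))
      exact intervalIntegral.continuous_parametric_intervalIntegral_of_continuous' this 0 1
    have hg : Continuous fun y => wN m y * ∫ x in (0:ℝ)..1, wN n x * S0 c d x y := (wN_continuous m).mul hI
    have := intervalIntegral.integral_lt_integral_of_continuousOn_of_le_of_exists_lt zero_lt_one
      (f := fun _ => (0:ℝ)) (g := fun y => wN m y * ∫ x in (0:ℝ)..1, wN n x * S0 c d x y) continuousOn_const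
      hg.continuousOn
      (fun y hy => mul_nonneg (wN_nonneg m hy.1.le) (eleven_inner_nonneg c d hsp n ⟨hy.1.le, hy.2⟩))
      ⟨δ / 2, ⟨by linarith, by linarith⟩,
        mul_pos (wN_pos m (by linarith))
          (eleven_inner_pos c d hsp n hδ hδ1 hpos ⟨by linarith, by linarith⟩ (by rw [abs_of_pos (by linarith)]; linarith))⟩
    simpa using this

end eleven2


/-! ## eq. (prims): the closed forms `nuSumLe`, `nuDiffGe`, `nuRect` ARE the polygon integrals of `ν = pq dp dq`
on `[x,1]×[y,1]` (toward Lemma QI / the `Mixture` Prop) -/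

section prims

/-- `∫_{(a,b]} P (c₀ + c₁P + c₂P²) dP = intP c₀ c₁ c₂ a b` (empty range ↦ 0 on both sides) [cite: BuiHall2023, §1 Conjecture 1 — a step of THIS TREE's proof of it (box write-up paper-v3-d979a68f eq. (prims): the closed forms `nuSumLe`; `nuDiffGe`; `nuRect` ARE the ); the cited paper states the conjecture and the proof is ours] -/
theorem setIntegral_Ioc_poly (c0 c1 c2 a b : ℝ) :
    ∫ P in Ioc a b, P * (c0 + c1 * P + c2 * P ^ 2) = intP c0 c1 c2 a b := by
  unfold intP
  rcases le_or_gt a b with hab | hab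
  · rw [max_eq_right hab, ← intervalIntegral.integral_of_le hab]
    have e : ∀ P : ℝ, P * (c0 + c1 * P + c2 * P ^ 2) = (c0 * P ^ 1 + c1 * P ^ 2) + c2 * P ^ 3 := fun P => by ring
    simp_rw [e]
    have i1 : IntervalIntegrable (fun P : ℝ => c0 * P ^ 1 + c1 * P ^ 2) volume a b := by
      apply Continuous.intervalIntegrable; fun_prop
    have i2 : IntervalIntegrable (fun P : ℝ => c2 * P ^ 3) volume a b := by
      apply Continuous.intervalIntegrable; fun_prop
    have i3 : IntervalIntegrable (fun P : ℝ => c0 * P ^ 1) volume a b := by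
      apply Continuous.intervalIntegrable; fun_prop
    have i4 : IntervalIntegrable (fun P : ℝ => c1 * P ^ 2) volume a b := by
      apply Continuous.intervalIntegrable; fun_prop
    rw [intervalIntegral.integral_add i1 i2, intervalIntegral.integral_add i3 i4,
      intervalIntegral.integral_const_mul, intervalIntegral.integral_const_mul, intervalIntegral.integral_const_mul,
      integral_pow, integral_pow, integral_pow]
    unfold Fp; push_cast; ring
  · rw [max_eq_left hab.le, sub_self, Set.Ioc_eq_empty (not_lt.mpr hab.le), setIntegral_empty]

/-- the inner `Q`-integral: `∫_{(y,1] ∩ {Q ≤ m}} P Q dQ = P · intP 1 0 0 y (min 1 m)` [cite: BuiHall2023, §1 Conjecture 1 — a step of THIS TREE's proof of it (box write-up paper-v3-d979a68f eq. (prims): the closed forms `nuSumLe`; `nuDiffGe`; `nuRect` ARE the ); the cited paper states the conjecture and the proof is ours] -/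
theorem inner_Q_cut (P y m : ℝ) :
    ∫ Q in Ioc y 1, (if Q ≤ m then P * Q else 0) = P * intP 1 0 0 y (min 1 m) := by
  have e : (fun Q => if Q ≤ m then P * Q else 0) = Set.indicator (Iic m) (fun Q => P * Q) := by
    ext Q; simp only [Set.indicator_apply, mem_Iic]
  rw [e, setIntegral_indicator measurableSet_Iic, Set.Ioc_inter_Iic, MeasureTheory.integral_const_mul]
  congr 1
  rw [← setIntegral_Ioc_poly 1 0 0 y (min 1 m)]
  apply setIntegral_congr_fun measurableSet_Ioc; intro Q _; simp only; ring

/-- Auxiliary lemma `intP100` of the Bui–Hall sign-conjecture leg (eq. (prims): the closed forms `nuSumLe`, `nuDiffGe`, `nuRect` ARE the polygon integrals of `ν = pq dp dq`); statement as displayed, box port verbatim. [cite: BuiHall2023, §1 Conjecture 1 — a step of THIS TREE's proof of it (box write-up paper-v3-d979a68f eq. (prims): the closed forms `nuSumLe`; `nuDiffGe`; `nuRect` ARE the ); the cited paper states the conjecture and the proof is ours] -/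
theorem intP100 (y m : ℝ) : intP 1 0 0 y m = ((max y m) ^ 2 - y ^ 2) / 2 := by
  unfold intP Fp; ring

/-- **ν{P − Q ≥ t} = nuDiffGe t x y** on `[x,1]×[y,1]`, `t ≥ 0` [cite: BuiHall2023, §1 Conjecture 1 — a step of THIS TREE's proof of it (box write-up paper-v3-d979a68f eq. (prims): the closed forms `nuSumLe`; `nuDiffGe`; `nuRect` ARE the ); the cited paper states the conjecture and the proof is ours] -/
theorem nuDiffGe_eq {t x y : ℝ} (ht : 0 ≤ t) (hx : x ∈ Icc (0:ℝ) 1) (hy : y ∈ Icc (0:ℝ) 1) :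
    (∫ P in x..1, ∫ Q in y..1, (if t ≤ P - Q then P * Q else 0)) = nuDiffGe t x y := by
  set φ : ℝ → ℝ := fun P => P * ((t * t - y * y) / 2 + (-t) * P + (1/2 : ℝ) * P ^ 2) with hφ
  have step1 : ∀ P ∈ Set.uIcc x 1, (∫ Q in y..1, (if t ≤ P - Q then P * Q else 0)) = Set.indicator (Ioi (y + t)) φ P := by
    intro P hP
    rw [Set.uIcc_of_le hx.2] at hP
    rw [intervalIntegral.integral_of_le hy.2]
    have e : (fun Q => if t ≤ P - Q then P * Q else 0) = fun Q => if Q ≤ P - t then P * Q else 0 := by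
      ext Q
      have : (t ≤ P - Q) ↔ (Q ≤ P - t) := by constructor <;> intro h <;> linarith
      simp only [this]
    rw [e, inner_Q_cut, intP100, min_eq_right (by linarith [hP.2] : P - t ≤ 1)]
    simp only [Set.indicator_apply, mem_Ioi, hφ]
    split_ifs with h
    · rw [max_eq_right (by linarith)]; ring
    · rw [max_eq_left (by linarith)]; ring
  rw [intervalIntegral.integral_congr step1, intervalIntegral.integral_of_le hx.2,
    setIntegral_indicator measurableSet_Ioi, Set.Ioc_inter_Ioi, hφ, setIntegral_Ioc_poly]
  rfl

/-- Auxiliary lemma `min_min_eq` of the Bui–Hall sign-conjecture leg (eq. (prims): the closed forms `nuSumLe`, `nuDiffGe`, `nuRect` ARE the polygon integrals of `ν = pq dp dq`); statement as displayed, box port verbatim. [cite: BuiHall2023, §1 Conjecture 1 — a step of THIS TREE's proof of it (box write-up paper-v3-d979a68f eq. (prims): the closed forms `nuSumLe`; `nuDiffGe`; `nuRect` ARE the ); the cited paper states the conjecture and the proof is ours] -/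
theorem min_min_eq {t y : ℝ} (hy : y ≤ 1) : min (min 1 (t - y)) (t - 1) = min 1 (t - 1) := by
  rw [min_assoc, min_eq_right (by linarith : t - 1 ≤ t - y)]

/-- **ν{P + Q ≤ t} = nuSumLe t x y** on `[x,1]×[y,1]` [cite: BuiHall2023, §1 Conjecture 1 — a step of THIS TREE's proof of it (box write-up paper-v3-d979a68f eq. (prims): the closed forms `nuSumLe`; `nuDiffGe`; `nuRect` ARE the ); the cited paper states the conjecture and the proof is ours] -/
theorem nuSumLe_eq {t x y : ℝ} (hx : x ∈ Icc (0:ℝ) 1) (hy : y ∈ Icc (0:ℝ) 1) :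
    (∫ P in x..1, ∫ Q in y..1, (if P + Q ≤ t then P * Q else 0)) = nuSumLe t x y := by
  set φ₁ : ℝ → ℝ := fun P => P * ((1 - y * y) / 2 + 0 * P + 0 * P ^ 2) with hφ₁
  set φ₂ : ℝ → ℝ := fun P => P * ((t * t - y * y) / 2 + (-t) * P + (1/2 : ℝ) * P ^ 2) with hφ₂
  have step1 : ∀ P ∈ Set.uIcc x 1, (∫ Q in y..1, (if P + Q ≤ t then P * Q else 0))
      = Set.indicator (Iic (t - 1)) φ₁ P + Set.indicator (Ioc (t - 1) (t - y)) φ₂ P := by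
    intro P hP
    rw [Set.uIcc_of_le hx.2] at hP
    rw [intervalIntegral.integral_of_le hy.2]
    have e : (fun Q => if P + Q ≤ t then P * Q else 0) = fun Q => if Q ≤ t - P then P * Q else 0 := by
      ext Q
      have : (P + Q ≤ t) ↔ (Q ≤ t - P) := by constructor <;> intro h <;> linarith
      simp only [this]
    rw [e, inner_Q_cut, intP100]
    simp only [Set.indicator_apply, mem_Iic, mem_Ioc, hφ₁, hφ₂]
    by_cases h1 : P ≤ t - 1
    · rw [if_pos h1, if_neg (fun h => by linarith [h.1]), min_eq_left (by linarith : (1:ℝ) ≤ t - P),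
        max_eq_right hy.2]; ring
    · rw [if_neg h1]
      have h1' : t - 1 < P := not_le.mp h1
      rw [min_eq_right (by linarith : t - P ≤ 1)]
      by_cases h2 : P ≤ t - y
      · rw [if_pos ⟨h1', h2⟩, max_eq_right (by linarith)]; ring
      · have h2' : t - y < P := not_le.mp h2
        rw [if_neg (fun h => h2 h.2), max_eq_left (by linarith)]; ring
  rw [intervalIntegral.integral_congr step1, intervalIntegral.integral_of_le hx.2]
  have hI1 : IntegrableOn (Set.indicator (Iic (t - 1)) φ₁) (Ioc x 1) := by
    apply IntegrableOn.indicator _ measurableSet_Iic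
    exact ((by simp only [hφ₁]; fun_prop : Continuous φ₁).integrableOn_Icc).mono_set Ioc_subset_Icc_self
  have hI2 : IntegrableOn (Set.indicator (Ioc (t - 1) (t - y)) φ₂) (Ioc x 1) := by
    apply IntegrableOn.indicator _ measurableSet_Ioc
    exact ((by simp only [hφ₂]; fun_prop : Continuous φ₂).integrableOn_Icc).mono_set Ioc_subset_Icc_self
  rw [integral_add hI1 hI2, setIntegral_indicator measurableSet_Iic, setIntegral_indicator measurableSet_Ioc,
    Set.Ioc_inter_Iic, Set.Ioc_inter_Ioc, hφ₁, hφ₂, setIntegral_Ioc_poly, setIntegral_Ioc_poly]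
  unfold nuSumLe
  rw [min_min_eq hy.2]

/-- **ν(R) = nuRect x y** [cite: BuiHall2023, §1 Conjecture 1 — a step of THIS TREE's proof of it (box write-up paper-v3-d979a68f eq. (prims): the closed forms `nuSumLe`; `nuDiffGe`; `nuRect` ARE the ); the cited paper states the conjecture and the proof is ours] -/
theorem nuRect_eq (x y : ℝ) : (∫ P in x..1, ∫ Q in y..1, P * Q) = nuRect x y := by
  have e : ∀ P : ℝ, ∫ Q in y..1, P * Q = P * ((1 - y * y) / 2) := by
    intro P; rw [intervalIntegral.integral_const_mul, integral_id]; ring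
  simp_rw [e]
  rw [intervalIntegral.integral_mul_const, integral_id]
  unfold nuRect; ring

end prims


/-! ## Lemma QI — part 1: the truncated profile `f̃_x`, `F̃ = f̃_x ∗ f̃_y`, its window integrals, and the fold to `P ∈ [x,1]` -/

section qi1

/-- `f̃_x(p) = p · 1[x ≤ |p| ≤ 1]` [folklore] -/
noncomputable def ft (x p : ℝ) : ℝ := if x ≤ |p| ∧ |p| ≤ 1 then p else 0
/-- `F̃(s) = (f̃_x ∗ f̃_y)(s) = ∫_{-1}^{1} f̃_x(p) f̃_y(s-p) dp` [folklore] -/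
noncomputable def JT (x y s : ℝ) : ℝ := ∫ p in (-1:ℝ)..1, ft x p * ft y (s - p)
/-- `G(z) = ∫_0^z f̃_y` [folklore] -/
noncomputable def Gt (y z : ℝ) : ℝ := ∫ q in (0:ℝ)..z, ft y q

/-- Auxiliary lemma `ft_neg` of the Bui–Hall sign-conjecture leg (Lemma QI — part 1: the truncated profile `f̃_x`, `F̃ = f̃_x ∗ f̃_y`, its window integrals, and the fold to …); statement as displayed, box port verbatim. [cite: BuiHall2023, §1 Conjecture 1 — a step of THIS TREE's proof of it (box write-up paper-v3-d979a68f Lemma QI — part 1: the truncated profile `f̃_x`; `F̃ = f̃_x ∗ f̃_y`; i); the cited paper states the conjecture and the proof is ours] -/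
theorem ft_neg (x p : ℝ) : ft x (-p) = -ft x p := by
  unfold ft; rw [abs_neg]; split_ifs <;> ring

/-- Auxiliary lemma `ft_abs_le` of the Bui–Hall sign-conjecture leg (Lemma QI — part 1: the truncated profile `f̃_x`, `F̃ = f̃_x ∗ f̃_y`, its window integrals, and the fold to …); statement as displayed, box port verbatim. [cite: BuiHall2023, §1 Conjecture 1 — a step of THIS TREE's proof of it (box write-up paper-v3-d979a68f Lemma QI — part 1: the truncated profile `f̃_x`; `F̃ = f̃_x ∗ f̃_y`; i); the cited paper states the conjecture and the proof is ours] -/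
theorem ft_abs_le (x p : ℝ) : |ft x p| ≤ 1 := by
  unfold ft; split_ifs with h
  · exact h.2
  · simp

/-- Auxiliary lemma `measurableSet_ft` of the Bui–Hall sign-conjecture leg (Lemma QI — part 1: the truncated profile `f̃_x`, `F̃ = f̃_x ∗ f̃_y`, its window integrals, and the fold to …); statement as displayed, box port verbatim. [cite: BuiHall2023, §1 Conjecture 1 — a step of THIS TREE's proof of it (box write-up paper-v3-d979a68f Lemma QI — part 1: the truncated profile `f̃_x`; `F̃ = f̃_x ∗ f̃_y`; i); the cited paper states the conjecture and the proof is ours] -/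
theorem measurableSet_ft (x : ℝ) : MeasurableSet {p : ℝ | x ≤ |p| ∧ |p| ≤ 1} := by
  have e : {p : ℝ | x ≤ |p| ∧ |p| ≤ 1} = {p : ℝ | x ≤ |p|} ∩ {p : ℝ | |p| ≤ 1} := by ext p; simp
  rw [e]
  exact (measurableSet_le measurable_const continuous_abs.measurable).inter
    (measurableSet_le continuous_abs.measurable measurable_const)

/-- Auxiliary lemma `ft_measurable` of the Bui–Hall sign-conjecture leg (Lemma QI — part 1: the truncated profile `f̃_x`, `F̃ = f̃_x ∗ f̃_y`, its window integrals, and the fold to …); statement as displayed, box port verbatim. [cite: BuiHall2023, §1 Conjecture 1 — a step of THIS TREE's proof of it (box write-up paper-v3-d979a68f Lemma QI — part 1: the truncated profile `f̃_x`; `F̃ = f̃_x ∗ f̃_y`; i); the cited paper states the conjecture and the proof is ours] -/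
theorem ft_measurable (x : ℝ) : Measurable (ft x) := by
  unfold ft
  exact Measurable.ite (measurableSet_ft x) measurable_id measurable_const

/-- Auxiliary lemma `ft_eq_indicator` of the Bui–Hall sign-conjecture leg (Lemma QI — part 1: the truncated profile `f̃_x`, `F̃ = f̃_x ∗ f̃_y`, its window integrals, and the fold to …); statement as displayed, box port verbatim. [cite: BuiHall2023, §1 Conjecture 1 — a step of THIS TREE's proof of it (box write-up paper-v3-d979a68f Lemma QI — part 1: the truncated profile `f̃_x`; `F̃ = f̃_x ∗ f̃_y`; i); the cited paper states the conjecture and the proof is ours] -/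
theorem ft_eq_indicator (x : ℝ) : ft x = Set.indicator {p : ℝ | x ≤ |p| ∧ |p| ≤ 1} id := by
  ext p; unfold ft; simp only [Set.indicator_apply, mem_setOf_eq, id]

/-- bounded measurable functions are interval integrable [cite: BuiHall2023, §1 Conjecture 1 — a step of THIS TREE's proof of it (box write-up paper-v3-d979a68f Lemma QI — part 1: the truncated profile `f̃_x`; `F̃ = f̃_x ∗ f̃_y`; i); the cited paper states the conjecture and the proof is ours] -/
theorem intervalIntegrable_of_bounded_measurable {f : ℝ → ℝ} (hf : Measurable f) {C : ℝ} (hC : ∀ x, |f x| ≤ C)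
    (a b : ℝ) : IntervalIntegrable f volume a b := by
  refine (intervalIntegrable_const (c := C)).mono_fun hf.aestronglyMeasurable ?_
  refine Filter.Eventually.of_forall fun x => ?_
  show ‖f x‖ ≤ ‖C‖
  rw [Real.norm_eq_abs, Real.norm_eq_abs]
  exact (hC x).trans (le_abs_self C)

/-- Auxiliary lemma `ft_intervalIntegrable` of the Bui–Hall sign-conjecture leg (Lemma QI — part 1: the truncated profile `f̃_x`, `F̃ = f̃_x ∗ f̃_y`, its window integrals, and the fold to …); statement as displayed, box port verbatim. [cite: BuiHall2023, §1 Conjecture 1 — a step of THIS TREE's proof of it (box write-up paper-v3-d979a68f Lemma QI — part 1: the truncated profile `f̃_x`; `F̃ = f̃_x ∗ f̃_y`; i); the cited paper states the conjecture and the proof is ours] -/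
theorem ft_intervalIntegrable (x a b : ℝ) : IntervalIntegrable (ft x) volume a b :=
  intervalIntegrable_of_bounded_measurable (ft_measurable x) (ft_abs_le x) a b

/-- Auxiliary lemma `Gt_continuous` of the Bui–Hall sign-conjecture leg (Lemma QI — part 1: the truncated profile `f̃_x`, `F̃ = f̃_x ∗ f̃_y`, its window integrals, and the fold to …); statement as displayed, box port verbatim. [cite: BuiHall2023, §1 Conjecture 1 — a step of THIS TREE's proof of it (box write-up paper-v3-d979a68f Lemma QI — part 1: the truncated profile `f̃_x`; `F̃ = f̃_x ∗ f̃_y`; i); the cited paper states the conjecture and the proof is ours] -/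
theorem Gt_continuous (y : ℝ) : Continuous (Gt y) := by
  unfold Gt
  exact intervalIntegral.continuous_primitive (fun a b => ft_intervalIntegrable y a b) 0

/-- Auxiliary lemma `Gt_neg` of the Bui–Hall sign-conjecture leg (Lemma QI — part 1: the truncated profile `f̃_x`, `F̃ = f̃_x ∗ f̃_y`, its window integrals, and the fold to …); statement as displayed, box port verbatim. [cite: BuiHall2023, §1 Conjecture 1 — a step of THIS TREE's proof of it (box write-up paper-v3-d979a68f Lemma QI — part 1: the truncated profile `f̃_x`; `F̃ = f̃_x ∗ f̃_y`; i); the cited paper states the conjecture and the proof is ours] -/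
theorem Gt_neg (y z : ℝ) : Gt y (-z) = Gt y z := by
  unfold Gt
  have h := intervalIntegral.integral_comp_neg (a := (0:ℝ)) (b := z) (fun q => ft y q)
  simp only [ft_neg, intervalIntegral.integral_neg, neg_zero] at h
  -- h : -(∫ q in 0..z, ft y q) = ∫ q in -z..0, ft y q
  have h2 : ∫ q in (0:ℝ)..(-z), ft y q = -∫ q in (-z)..(0:ℝ), ft y q := intervalIntegral.integral_symm _ _
  rw [h2, ← h, neg_neg]

/-- `G(z) = intP 1 0 0 y (min 1 z)` for `y, z ≥ 0` [cite: BuiHall2023, §1 Conjecture 1 — a step of THIS TREE's proof of it (box write-up paper-v3-d979a68f Lemma QI — part 1: the truncated profile `f̃_x`; `F̃ = f̃_x ∗ f̃_y`; i); the cited paper states the conjecture and the proof is ours] -/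
theorem Gt_of_nonneg {y z : ℝ} (hy : 0 ≤ y) (hz : 0 ≤ z) : Gt y z = intP 1 0 0 y (min 1 z) := by
  unfold Gt
  rw [intervalIntegral.integral_of_le hz]
  have e1 : ∫ q in Ioc 0 z, ft y q = ∫ q in Ioc 0 z, Set.indicator (Icc y 1) (fun q => q * (1 + 0 * q + 0 * q ^ 2)) q := by
    apply setIntegral_congr_fun measurableSet_Ioc
    intro q hq
    unfold ft
    simp only [Set.indicator_apply, mem_Icc, abs_of_pos hq.1]
    split_ifs <;> ring
  rw [e1, setIntegral_indicator measurableSet_Icc, ← setIntegral_Ioc_poly]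
  apply setIntegral_congr_set
  have h1 : (Ioc 0 z ∩ Icc y 1 : Set ℝ) =ᵐ[volume] (Icc 0 z ∩ Icc y 1 : Set ℝ) :=
    (Ioc_ae_eq_Icc (μ := volume)).inter (ae_eq_refl _)
  rw [Set.Icc_inter_Icc, max_eq_right hy, min_comm] at h1
  exact h1.trans (Ioc_ae_eq_Icc (μ := volume)).symm

/-- Auxiliary lemma `Gt_eq` of the Bui–Hall sign-conjecture leg (Lemma QI — part 1: the truncated profile `f̃_x`, `F̃ = f̃_x ∗ f̃_y`, its window integrals, and the fold to …); statement as displayed, box port verbatim. [cite: BuiHall2023, §1 Conjecture 1 — a step of THIS TREE's proof of it (box write-up paper-v3-d979a68f Lemma QI — part 1: the truncated profile `f̃_x`; `F̃ = f̃_x ∗ f̃_y`; i); the cited paper states the conjecture and the proof is ours] -/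
theorem Gt_eq {y : ℝ} (hy : 0 ≤ y) (z : ℝ) : Gt y z = intP 1 0 0 y (min 1 |z|) := by
  rcases le_or_gt 0 z with hz | hz
  · rw [abs_of_nonneg hz]; exact Gt_of_nonneg hy hz
  · rw [abs_of_neg hz, ← Gt_neg]; exact Gt_of_nonneg hy (by linarith)

/-- Auxiliary lemma `Gt_abs_le` of the Bui–Hall sign-conjecture leg (Lemma QI — part 1: the truncated profile `f̃_x`, `F̃ = f̃_x ∗ f̃_y`, its window integrals, and the fold to …); statement as displayed, box port verbatim. [cite: BuiHall2023, §1 Conjecture 1 — a step of THIS TREE's proof of it (box write-up paper-v3-d979a68f Lemma QI — part 1: the truncated profile `f̃_x`; `F̃ = f̃_x ∗ f̃_y`; i); the cited paper states the conjecture and the proof is ours] -/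
theorem Gt_abs_le {y : ℝ} (hy : y ∈ Icc (0:ℝ) 1) (z : ℝ) : |Gt y z| ≤ 1 := by
  rw [Gt_eq hy.1, intP100]
  have h1 : y ≤ max y (min 1 |z|) := le_max_left _ _
  have h2 : max y (min 1 |z|) ≤ 1 := max_le hy.2 (min_le_left _ _)
  rw [abs_le]; constructor <;> nlinarith [hy.1, hy.2]

/-- `P · G(z) = ∫_y^1 1[Q ≤ |z|] P Q dQ` (`y ∈ [0,1]`) [cite: BuiHall2023, §1 Conjecture 1 — a step of THIS TREE's proof of it (box write-up paper-v3-d979a68f Lemma QI — part 1: the truncated profile `f̃_x`; `F̃ = f̃_x ∗ f̃_y`; i); the cited paper states the conjecture and the proof is ours] -/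
theorem P_mul_Gt {y : ℝ} (hy : y ∈ Icc (0:ℝ) 1) (P z : ℝ) :
    P * Gt y z = ∫ Q in y..1, (if Q ≤ |z| then P * Q else 0) := by
  rw [Gt_eq hy.1, intervalIntegral.integral_of_le hy.2, inner_Q_cut]

/-- (Q1) `∫_a^b F̃ = ∫_{-1}^{1} f̃_x(p) (G(b-p) - G(a-p)) dp` [cite: BuiHall2023, §1 Conjecture 1 — a step of THIS TREE's proof of it (box write-up paper-v3-d979a68f Lemma QI — part 1: the truncated profile `f̃_x`; `F̃ = f̃_x ∗ f̃_y`; i); the cited paper states the conjecture and the proof is ours] -/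
theorem JT_window (x y a b : ℝ) :
    ∫ s in a..b, JT x y s = ∫ p in (-1:ℝ)..1, ft x p * (Gt y (b - p) - Gt y (a - p)) := by
  unfold JT
  rw [MeasureTheory.intervalIntegral_intervalIntegral_swap]
  · apply intervalIntegral.integral_congr; intro p _
    simp only
    rw [intervalIntegral.integral_const_mul, intervalIntegral.integral_comp_sub_right (fun q => ft y q) p]
    unfold Gt
    rw [intervalIntegral.integral_interval_sub_left (ft_intervalIntegrable y _ _) (ft_intervalIntegrable y _ _)]
  · -- bounded measurable on a rectangle of finite measure
    have hm : Measurable (Function.uncurry fun s p : ℝ => ft x p * ft y (s - p)) :=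
      ((ft_measurable x).comp measurable_snd).mul ((ft_measurable y).comp (measurable_fst.sub measurable_snd))
    have hR : MeasurableSet (Set.uIoc a b ×ˢ Set.uIoc (-1:ℝ) 1) := measurableSet_uIoc.prod measurableSet_uIoc
    have hvol : volume (Set.uIoc a b ×ˢ Set.uIoc (-1:ℝ) 1) ≠ ⊤ := by
      rw [Measure.volume_eq_prod, Measure.prod_prod]
      exact ENNReal.mul_ne_top (by rw [Set.uIoc, Real.volume_Ioc]; exact ENNReal.ofReal_ne_top)
        (by rw [Set.uIoc, Real.volume_Ioc]; exact ENNReal.ofReal_ne_top)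
    refine (integrableOn_const hvol (C := (1:ℝ))).mono' hm.aestronglyMeasurable ?_
    refine Filter.Eventually.of_forall fun z => ?_
    simp only [Function.uncurry, Real.norm_eq_abs, abs_mul]
    calc |ft x z.2| * |ft y (z.1 - z.2)| ≤ 1 * 1 := by
          apply mul_le_mul (ft_abs_le _ _) (ft_abs_le _ _) (abs_nonneg _) zero_le_one
      _ = 1 := by ring

/-- (Q3) fold `p ∈ [-1,1]` onto `P ∈ [x,1]` [cite: BuiHall2023, §1 Conjecture 1 — a step of THIS TREE's proof of it (box write-up paper-v3-d979a68f Lemma QI — part 1: the truncated profile `f̃_x`; `F̃ = f̃_x ∗ f̃_y`; i); the cited paper states the conjecture and the proof is ours] -/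
theorem JT_window_fold {x y : ℝ} (hx : x ∈ Icc (0:ℝ) 1) (hy : y ∈ Icc (0:ℝ) 1) (a b : ℝ) :
    ∫ s in a..b, JT x y s
      = ∫ P in x..1, P * (Gt y (b - P) - Gt y (a - P) - Gt y (b + P) + Gt y (a + P)) := by
  rw [JT_window]
  set g : ℝ → ℝ := fun p => ft x p * (Gt y (b - p) - Gt y (a - p)) with hg
  have hgm : Measurable g :=
    (ft_measurable x).mul (((Gt_continuous y).comp (continuous_const.sub continuous_id)).sub
        ((Gt_continuous y).comp (continuous_const.sub continuous_id))).measurable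
  have hgb : ∀ p, |g p| ≤ 2 := by
    intro p; simp only [hg]; rw [abs_mul]
    calc |ft x p| * |Gt y (b - p) - Gt y (a - p)| ≤ 1 * (1 + 1) := by
          apply mul_le_mul (ft_abs_le _ _) _ (abs_nonneg _) zero_le_one
          exact (abs_sub _ _).trans (add_le_add (Gt_abs_le hy _) (Gt_abs_le hy _))
      _ = 2 := by ring
  have hgi : ∀ c d : ℝ, IntervalIntegrable g volume c d := fun c d =>
    intervalIntegrable_of_bounded_measurable hgm hgb c d
  change ∫ p in (-1:ℝ)..1, g p = _
  rw [← intervalIntegral.integral_add_adjacent_intervals (hgi (-1) 0) (hgi 0 1)]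
  have hneg : ∫ p in (-1:ℝ)..0, g p = ∫ P in (0:ℝ)..1, g (-P) := by
    rw [intervalIntegral.integral_comp_neg (fun p => g p)]; simp
  have hgn : IntervalIntegrable (fun P => g (-P)) volume 0 1 :=
    intervalIntegrable_of_bounded_measurable (hgm.comp measurable_neg) (fun p => hgb (-p)) 0 1
  rw [hneg, ← intervalIntegral.integral_add hgn (hgi 0 1)]
  -- now both sides are integrals over [0,1]; cut at x
  have e : ∀ P ∈ Set.uIcc (0:ℝ) 1, g (-P) + g P
      = Set.indicator (Ici x) (fun P => P * (Gt y (b - P) - Gt y (a - P) - Gt y (b + P) + Gt y (a + P))) P := by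
    intro P hP
    rw [Set.uIcc_of_le zero_le_one] at hP
    simp only [hg, ft_neg, Set.indicator_apply, mem_Ici, sub_neg_eq_add]
    unfold ft
    rw [abs_of_nonneg hP.1]
    by_cases h : x ≤ P
    · rw [if_pos ⟨h, hP.2⟩, if_pos h]; ring
    · rw [if_neg (fun h' => h h'.1), if_neg h]; ring
  rw [intervalIntegral.integral_congr e, integral_indicator_Ici hx]

end qi1


/-! ## Lemma QI — part 2: `∫_{v-u}^{1-u} F̃ + ∫_{u+v}^{1+u} F̃ = Lam u v x y` (Lemma QI + eq. (LamN) + eq. (prims), PROVED) -/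

section qi2

/-- LHS kernel block for an endpoint `t`: `1[Q ≤ |t-P|]PQ − 1[Q ≤ t+P]PQ` [folklore] -/
noncomputable def kA (t P Q : ℝ) : ℝ := (if Q ≤ |t - P| then P * Q else 0) - (if Q ≤ t + P then P * Q else 0)
/-- RHS kernel block: `1[P+Q ≤ t]PQ + 1[P−Q ≥ t]PQ + 1[Q−P ≥ t]PQ − PQ` [folklore] -/
noncomputable def kB (t P Q : ℝ) : ℝ :=
  (if P + Q ≤ t then P * Q else 0) + (if t ≤ P - Q then P * Q else 0) + (if t ≤ Q - P then P * Q else 0) - P * Q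

/-- the pointwise identity behind Lemma QI (off the line `Q = t + P`) [cite: BuiHall2023, §1 Conjecture 1 — a step of THIS TREE's proof of it (box write-up paper-v3-d979a68f Lemma QI — part 2: `∫_{v-u}^{1-u} F̃ + ∫_{u+v}^{1+u} F̃ = Lam u v x y`); the cited paper states the conjecture and the proof is ours] -/
theorem kA_eq_kB {t P Q : ℝ} (ht : 0 ≤ t) (hP : 0 ≤ P) (hQ : 0 < Q) (hne : Q ≠ t + P) : kA t P Q = kB t P Q := by
  unfold kA kB
  rcases le_or_gt P t with hPt | hPt
  · rw [abs_of_nonneg (by linarith : 0 ≤ t - P)]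
    rcases lt_or_gt_of_ne hne with h1 | h1
    · split_ifs <;> first | (exfalso; linarith) | ring
    · split_ifs <;> first | (exfalso; linarith) | ring
  · rw [abs_of_neg (by linarith : t - P < 0)]
    rcases lt_or_gt_of_ne hne with h1 | h1
    · split_ifs <;> first | (exfalso; linarith) | ring
    · split_ifs <;> first | (exfalso; linarith) | ring

/-- interval integrability of `1[c] f` for a measurable condition and continuous `f` [cite: BuiHall2023, §1 Conjecture 1 — a step of THIS TREE's proof of it (box write-up paper-v3-d979a68f Lemma QI — part 2: `∫_{v-u}^{1-u} F̃ + ∫_{u+v}^{1+u} F̃ = Lam u v x y`); the cited paper states the conjecture and the proof is ours] -/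
theorem ii_ite {c : ℝ → Prop} [DecidablePred c] (hc : MeasurableSet {Q | c Q}) {f : ℝ → ℝ} (hf : Continuous f)
    (a b : ℝ) : IntervalIntegrable (fun Q => if c Q then f Q else 0) volume a b := by
  refine (hf.intervalIntegrable a b).mono_fun
    (Measurable.ite hc hf.measurable measurable_const).aestronglyMeasurable ?_
  refine Filter.Eventually.of_forall fun Q => ?_
  show ‖(if c Q then f Q else 0)‖ ≤ ‖f Q‖
  split_ifs
  · exact le_rfl
  · rw [norm_zero]; exact norm_nonneg _

/-- Auxiliary lemma `kA_intervalIntegrable` of the Bui–Hall sign-conjecture leg (Lemma QI — part 2: `∫_{v-u}^{1-u} F̃ + ∫_{u+v}^{1+u} F̃ = Lam u v x y` (Lemma QI + eq. (LamN) + eq. (prims)…); statement as displayed, box port verbatim. [cite: BuiHall2023, §1 Conjecture 1 — a step of THIS TREE's proof of it (box write-up paper-v3-d979a68f Lemma QI — part 2: `∫_{v-u}^{1-u} F̃ + ∫_{u+v}^{1+u} F̃ = Lam u v x y`); the cited paper states the conjecture and the proof is ours] -/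
theorem kA_intervalIntegrable (t P a b : ℝ) : IntervalIntegrable (fun Q => kA t P Q) volume a b := by
  unfold kA
  exact (ii_ite (c := fun Q => Q ≤ |t - P|) measurableSet_Iic (by fun_prop) a b).sub
    (ii_ite (c := fun Q => Q ≤ t + P) measurableSet_Iic (by fun_prop) a b)

/-- Auxiliary lemma `kB_intervalIntegrable` of the Bui–Hall sign-conjecture leg (Lemma QI — part 2: `∫_{v-u}^{1-u} F̃ + ∫_{u+v}^{1+u} F̃ = Lam u v x y` (Lemma QI + eq. (LamN) + eq. (prims)…); statement as displayed, box port verbatim. [cite: BuiHall2023, §1 Conjecture 1 — a step of THIS TREE's proof of it (box write-up paper-v3-d979a68f Lemma QI — part 2: `∫_{v-u}^{1-u} F̃ + ∫_{u+v}^{1+u} F̃ = Lam u v x y`); the cited paper states the conjecture and the proof is ours] -/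
theorem kB_intervalIntegrable (t P a b : ℝ) : IntervalIntegrable (fun Q => kB t P Q) volume a b := by
  unfold kB
  refine (((ii_ite (c := fun Q => P + Q ≤ t) ?_ (by fun_prop) a b).add
    (ii_ite (c := fun Q => t ≤ P - Q) ?_ (by fun_prop) a b)).add
    (ii_ite (c := fun Q => t ≤ Q - P) ?_ (by fun_prop) a b)).sub ((by fun_prop : Continuous fun Q => P * Q).intervalIntegrable a b)
  · exact measurableSet_le (by fun_prop) measurable_const
  · exact measurableSet_le measurable_const (by fun_prop)
  · exact measurableSet_le measurable_const (by fun_prop)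

/-- `∫_y^1 kA t P Q dQ = P G(t-P) − P G(t+P)` [cite: BuiHall2023, §1 Conjecture 1 — a step of THIS TREE's proof of it (box write-up paper-v3-d979a68f Lemma QI — part 2: `∫_{v-u}^{1-u} F̃ + ∫_{u+v}^{1+u} F̃ = Lam u v x y`); the cited paper states the conjecture and the proof is ours] -/
theorem integral_kA {y : ℝ} (hy : y ∈ Icc (0:ℝ) 1) {t P : ℝ} (htP : 0 ≤ t + P) :
    ∫ Q in y..1, kA t P Q = P * Gt y (t - P) - P * Gt y (t + P) := by
  unfold kA
  rw [intervalIntegral.integral_sub (ii_ite (c := fun Q => Q ≤ |t - P|) measurableSet_Iic (by fun_prop) _ _)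
    (ii_ite (c := fun Q => Q ≤ t + P) measurableSet_Iic (by fun_prop) _ _), P_mul_Gt hy, P_mul_Gt hy,
    abs_of_nonneg htP]

/-- outer integrability of a parametric inner integral with a bounded measurable kernel [cite: BuiHall2023, §1 Conjecture 1 — a step of THIS TREE's proof of it (box write-up paper-v3-d979a68f Lemma QI — part 2: `∫_{v-u}^{1-u} F̃ + ∫_{u+v}^{1+u} F̃ = Lam u v x y`); the cited paper states the conjecture and the proof is ours] -/
theorem ii_param {K : ℝ → ℝ → ℝ} (hK : Measurable (Function.uncurry K)) {C : ℝ}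
    (hb : ∀ P ∈ Icc (0:ℝ) 1, ∀ Q ∈ Icc (0:ℝ) 1, |K P Q| ≤ C) {x y : ℝ} (hx : x ∈ Icc (0:ℝ) 1) (hy : y ∈ Icc (0:ℝ) 1) :
    IntervalIntegrable (fun P => ∫ Q in y..1, K P Q) volume x 1 := by
  have e : (fun P => ∫ Q in y..1, K P Q) = fun P => ∫ Q, K P Q ∂(volume.restrict (Ioc y 1)) := by
    ext P; rw [intervalIntegral.integral_of_le hy.2]
  have hm : Measurable fun P => ∫ Q in y..1, K P Q := by
    rw [e]; exact (hK.stronglyMeasurable.integral_prod_right').measurable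
  refine (intervalIntegrable_const (c := C)).mono_fun hm.aestronglyMeasurable ?_
  rw [Filter.EventuallyLE, MeasureTheory.ae_restrict_iff' measurableSet_uIoc]
  refine Filter.Eventually.of_forall fun P hP => ?_
  rw [Set.uIoc_of_le hx.2] at hP
  have hP' : P ∈ Icc (0:ℝ) 1 := ⟨hx.1.trans hP.1.le, hP.2⟩
  have := intervalIntegral.norm_integral_le_of_norm_le_const (a := y) (b := 1) (C := C) (f := fun Q => K P Q)
    (fun Q hQ => by
      rw [Set.uIoc_of_le hy.2] at hQ
      rw [Real.norm_eq_abs]; exact hb P hP' Q ⟨hy.1.trans hQ.1.le, hQ.2⟩)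
  refine this.trans ?_
  have hC0 : 0 ≤ C := (abs_nonneg _).trans (hb P hP' 0 ⟨le_rfl, zero_le_one⟩)
  have h1y : |1 - y| ≤ 1 := by rw [abs_of_nonneg (by linarith [hy.2])]; linarith [hy.1]
  show C * |1 - y| ≤ ‖C‖
  rw [Real.norm_eq_abs, abs_of_nonneg hC0]
  nlinarith

/-- Auxiliary lemma `ite_abs_le` of the Bui–Hall sign-conjecture leg (Lemma QI — part 2: `∫_{v-u}^{1-u} F̃ + ∫_{u+v}^{1+u} F̃ = Lam u v x y` (Lemma QI + eq. (LamN) + eq. (prims)…); statement as displayed, box port verbatim. [cite: BuiHall2023, §1 Conjecture 1 — a step of THIS TREE's proof of it (box write-up paper-v3-d979a68f Lemma QI — part 2: `∫_{v-u}^{1-u} F̃ + ∫_{u+v}^{1+u} F̃ = Lam u v x y`); the cited paper states the conjecture and the proof is ours] -/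
theorem ite_abs_le {c : Prop} [Decidable c] {P Q : ℝ} (hP : P ∈ Icc (0:ℝ) 1) (hQ : Q ∈ Icc (0:ℝ) 1) :
    |(if c then P * Q else 0)| ≤ 1 := by
  split_ifs
  · rw [abs_mul, abs_of_nonneg hP.1, abs_of_nonneg hQ.1]; nlinarith [hP.1, hP.2, hQ.1, hQ.2]
  · simp

/-- `ν{Q − P ≥ t}` in the `P`-outer order equals `nuDiffGe t y x` (Fubini + eq. (prims)) [cite: BuiHall2023, §1 Conjecture 1 — a step of THIS TREE's proof of it (box write-up paper-v3-d979a68f Lemma QI — part 2: `∫_{v-u}^{1-u} F̃ + ∫_{u+v}^{1+u} F̃ = Lam u v x y`); the cited paper states the conjecture and the proof is ours] -/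
theorem nuDiffGe_swap {t x y : ℝ} (ht : 0 ≤ t) (hx : x ∈ Icc (0:ℝ) 1) (hy : y ∈ Icc (0:ℝ) 1) :
    (∫ P in x..1, ∫ Q in y..1, (if t ≤ Q - P then P * Q else 0)) = nuDiffGe t y x := by
  rw [← nuDiffGe_eq ht hy hx, MeasureTheory.intervalIntegral_intervalIntegral_swap]
  · apply intervalIntegral.integral_congr; intro Q _
    apply intervalIntegral.integral_congr; intro P _
    simp only; split_ifs <;> ring
  · have : Function.uncurry (fun P Q : ℝ => if t ≤ Q - P then P * Q else 0)
        = fun z : ℝ × ℝ => if t ≤ z.2 - z.1 then z.1 * z.2 else 0 := by ext ⟨P, Q⟩; rfl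
    rw [this]
    have hK : IsCompact (Set.uIcc x 1 ×ˢ Set.uIcc y 1) := isCompact_uIcc.prod isCompact_uIcc
    have heq : (fun z : ℝ × ℝ => if t ≤ z.2 - z.1 then z.1 * z.2 else 0)
        = Set.indicator {z : ℝ × ℝ | t ≤ z.2 - z.1} (fun z => z.1 * z.2) := by
      ext z; simp only [Set.indicator_apply, mem_setOf_eq]
    rw [heq]
    apply IntegrableOn.indicator _ (measurableSet_le measurable_const (by fun_prop))
    exact ((by fun_prop : Continuous fun z : ℝ × ℝ => z.1 * z.2).continuousOn.integrableOn_compact hK).mono_set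
      (Set.prod_mono Set.uIoc_subset_uIcc Set.uIoc_subset_uIcc)

/-- `−N(t) = ∫_x^1 ∫_y^1 kB t` (eq. (LamN)'s `N` through eq. (prims)) [cite: BuiHall2023, §1 Conjecture 1 — a step of THIS TREE's proof of it (box write-up paper-v3-d979a68f Lemma QI — part 2: `∫_{v-u}^{1-u} F̃ + ∫_{u+v}^{1+u} F̃ = Lam u v x y`); the cited paper states the conjecture and the proof is ours] -/
theorem neg_Nfun_eq {t x y : ℝ} (ht : 0 ≤ t) (hx : x ∈ Icc (0:ℝ) 1) (hy : y ∈ Icc (0:ℝ) 1) :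
    -Nfun t x y = ∫ P in x..1, ∫ Q in y..1, kB t P Q := by
  have m1 : MeasurableSet {Q : ℝ | (fun Q => True) Q} := MeasurableSet.univ
  -- inner linearity
  have inner : ∀ P, ∫ Q in y..1, kB t P Q = (∫ Q in y..1, (if P + Q ≤ t then P * Q else 0))
      + (∫ Q in y..1, (if t ≤ P - Q then P * Q else 0)) + (∫ Q in y..1, (if t ≤ Q - P then P * Q else 0))
      - ∫ Q in y..1, P * Q := by
    intro P
    unfold kB
    have i1 := ii_ite (c := fun Q => P + Q ≤ t) (measurableSet_le (by fun_prop) measurable_const)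
      (by fun_prop : Continuous fun Q => P * Q) y 1
    have i2 := ii_ite (c := fun Q => t ≤ P - Q) (measurableSet_le measurable_const (by fun_prop))
      (by fun_prop : Continuous fun Q => P * Q) y 1
    have i3 := ii_ite (c := fun Q => t ≤ Q - P) (measurableSet_le measurable_const (by fun_prop))
      (by fun_prop : Continuous fun Q => P * Q) y 1
    have i4 : IntervalIntegrable (fun Q => P * Q) volume y 1 :=
      (by fun_prop : Continuous fun Q => P * Q).intervalIntegrable y 1
    rw [intervalIntegral.integral_sub ((i1.add i2).add i3) i4, intervalIntegral.integral_add (i1.add i2) i3,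
      intervalIntegral.integral_add i1 i2]
  simp_rw [inner]
  -- outer linearity
  have j1 : IntervalIntegrable (fun P => ∫ Q in y..1, (if P + Q ≤ t then P * Q else 0)) volume x 1 :=
    ii_param (K := fun P Q => if P + Q ≤ t then P * Q else 0)
      (Measurable.ite (measurableSet_le (by fun_prop) measurable_const) (by fun_prop) measurable_const)
      (C := 1) (fun P hP Q hQ => ite_abs_le hP hQ) hx hy
  have j2 : IntervalIntegrable (fun P => ∫ Q in y..1, (if t ≤ P - Q then P * Q else 0)) volume x 1 :=
    ii_param (K := fun P Q => if t ≤ P - Q then P * Q else 0)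
      (Measurable.ite (measurableSet_le measurable_const (by fun_prop)) (by fun_prop) measurable_const)
      (C := 1) (fun P hP Q hQ => ite_abs_le hP hQ) hx hy
  have j3 : IntervalIntegrable (fun P => ∫ Q in y..1, (if t ≤ Q - P then P * Q else 0)) volume x 1 :=
    ii_param (K := fun P Q => if t ≤ Q - P then P * Q else 0)
      (Measurable.ite (measurableSet_le measurable_const (by fun_prop)) (by fun_prop) measurable_const)
      (C := 1) (fun P hP Q hQ => ite_abs_le hP hQ) hx hy
  have j4 : IntervalIntegrable (fun P => ∫ Q in y..1, P * Q) volume x 1 := by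
    apply Continuous.intervalIntegrable
    have : (fun P => ∫ Q in y..1, P * Q) = fun P => P * ∫ Q in y..1, Q := by
      ext P; rw [intervalIntegral.integral_const_mul]
    rw [this]; fun_prop
  rw [intervalIntegral.integral_sub ((j1.add j2).add j3) j4, intervalIntegral.integral_add (j1.add j2) j3,
    intervalIntegral.integral_add j1 j2, nuSumLe_eq hx hy, nuDiffGe_eq ht hx hy, nuDiffGe_swap ht hx hy, nuRect_eq]
  unfold Nfun; ring

/-- **Lemma QI with eq. (LamN)–(prims)**: the two-window integral of `F̃ = f̃_x ∗ f̃_y` equals the closed form `Lam`. [cite: BuiHall2023, §1 Conjecture 1 — a step of THIS TREE's proof of it (box write-up paper-v3-d979a68f Lemma QI — part 2: `∫_{v-u}^{1-u} F̃ + ∫_{u+v}^{1+u} F̃ = Lam u v x y`); the cited paper states the conjecture and the proof is ours] -/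
theorem core_QI {u v x y : ℝ} (hv : 0 ≤ v) (hvu : v ≤ u) (hu : u ≤ 1) (hx : x ∈ Icc (0:ℝ) 1) (hy : y ∈ Icc (0:ℝ) 1) :
    (∫ s in (v - u)..(1 - u), JT x y s) + ∫ s in (u + v)..(1 + u), JT x y s = Lam u v x y := by
  rw [JT_window_fold hx hy, JT_window_fold hx hy]
  -- LHS as one double integral of Σ sᵢ kA tᵢ
  set t₁ := 1 - u; set t₂ := u - v; set t₃ := 1 + u; set t₄ := u + v
  have ht₁ : 0 ≤ t₁ := by simp only [t₁]; linarith
  have ht₂ : 0 ≤ t₂ := by simp only [t₂]; linarith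
  have ht₃ : 0 ≤ t₃ := by simp only [t₃]; linarith [hv, hvu]
  have ht₄ : 0 ≤ t₄ := by simp only [t₄]; linarith
  have hGc := Gt_continuous y
  have cA : ∀ a b : ℝ, IntervalIntegrable (fun P => P * (Gt y (b - P) - Gt y (a - P) - Gt y (b + P) + Gt y (a + P))) volume x 1 := by
    intro a b; apply Continuous.intervalIntegrable; fun_prop
  rw [← intervalIntegral.integral_add (cA _ _) (cA _ _)]
  have lhs : ∀ P ∈ Set.uIcc x 1,
      P * (Gt y (1 - u - P) - Gt y (v - u - P) - Gt y (1 - u + P) + Gt y (v - u + P))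
        + P * (Gt y (1 + u - P) - Gt y (u + v - P) - Gt y (1 + u + P) + Gt y (u + v + P))
      = ∫ Q in y..1, (kA t₁ P Q + kA t₂ P Q + kA t₃ P Q - kA t₄ P Q) := by
    intro P hP
    rw [Set.uIcc_of_le hx.2] at hP
    have hP0 : 0 ≤ P := hx.1.trans hP.1
    rw [intervalIntegral.integral_sub (((kA_intervalIntegrable _ _ _ _).add (kA_intervalIntegrable _ _ _ _)).add
        (kA_intervalIntegrable _ _ _ _)) (kA_intervalIntegrable _ _ _ _),
      intervalIntegral.integral_add ((kA_intervalIntegrable _ _ _ _).add (kA_intervalIntegrable _ _ _ _))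
        (kA_intervalIntegrable _ _ _ _),
      intervalIntegral.integral_add (kA_intervalIntegrable _ _ _ _) (kA_intervalIntegrable _ _ _ _),
      integral_kA hy (by linarith), integral_kA hy (by linarith), integral_kA hy (by linarith),
      integral_kA hy (by linarith)]
    have e1 : Gt y (v - u - P) = Gt y (t₂ + P) := by rw [← Gt_neg]; congr 1; simp only [t₂]; ring
    have e2 : Gt y (v - u + P) = Gt y (t₂ - P) := by rw [← Gt_neg]; congr 1; simp only [t₂]; ring
    rw [e1, e2]
    simp only [t₁, t₃, t₄]
    ring_nf
  rw [intervalIntegral.integral_congr lhs]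
  -- RHS as one double integral of Σ sᵢ kB tᵢ
  have rhs : Lam u v x y = ∫ P in x..1, ∫ Q in y..1, (kB t₁ P Q + kB t₂ P Q + kB t₃ P Q - kB t₄ P Q) := by
    have eL : Lam u v x y = -Nfun t₁ x y + -Nfun t₂ x y + -Nfun t₃ x y - -Nfun t₄ x y := by
      unfold Lam; ring
    rw [eL, neg_Nfun_eq ht₁ hx hy, neg_Nfun_eq ht₂ hx hy, neg_Nfun_eq ht₃ hx hy, neg_Nfun_eq ht₄ hx hy]
    have hKm : ∀ t : ℝ, Measurable (Function.uncurry fun P Q : ℝ => kB t P Q) := by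
      intro t
      unfold kB
      refine ((Measurable.ite ?_ (by fun_prop) measurable_const).add
        (Measurable.ite ?_ (by fun_prop) measurable_const) |>.add
        (Measurable.ite ?_ (by fun_prop) measurable_const)).sub (by fun_prop)
      · exact measurableSet_le (by fun_prop) measurable_const
      · exact measurableSet_le measurable_const (by fun_prop)
      · exact measurableSet_le measurable_const (by fun_prop)
    have hKb : ∀ t : ℝ, ∀ P ∈ Icc (0:ℝ) 1, ∀ Q ∈ Icc (0:ℝ) 1, |kB t P Q| ≤ 4 := by
      intro t P hP Q hQ
      unfold kB
      have b1 := ite_abs_le (c := P + Q ≤ t) hP hQ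
      have b2 := ite_abs_le (c := t ≤ P - Q) hP hQ
      have b3 := ite_abs_le (c := t ≤ Q - P) hP hQ
      have b4 : |P * Q| ≤ 1 := by
        rw [abs_mul, abs_of_nonneg hP.1, abs_of_nonneg hQ.1]; nlinarith [hP.1, hP.2, hQ.1, hQ.2]
      set A := (if P + Q ≤ t then P * Q else 0)
      set B := (if t ≤ P - Q then P * Q else 0)
      set C' := (if t ≤ Q - P then P * Q else 0)
      have c1 := abs_sub (A + B + C') (P * Q)
      have c2 := abs_add_le (A + B) C'
      have c3 := abs_add_le A B
      linarith
    have jj : ∀ t : ℝ, IntervalIntegrable (fun P => ∫ Q in y..1, kB t P Q) volume x 1 :=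
      fun t => ii_param (hKm t) (hKb t) hx hy
    rw [← intervalIntegral.integral_add (jj t₁) (jj t₂), ← intervalIntegral.integral_add ((jj t₁).add (jj t₂)) (jj t₃),
      ← intervalIntegral.integral_sub (((jj t₁).add (jj t₂)).add (jj t₃)) (jj t₄)]
    apply intervalIntegral.integral_congr; intro P _
    simp only
    rw [intervalIntegral.integral_sub (((kB_intervalIntegrable _ _ _ _).add (kB_intervalIntegrable _ _ _ _)).add
        (kB_intervalIntegrable _ _ _ _)) (kB_intervalIntegrable _ _ _ _),
      intervalIntegral.integral_add ((kB_intervalIntegrable _ _ _ _).add (kB_intervalIntegrable _ _ _ _))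
        (kB_intervalIntegrable _ _ _ _),
      intervalIntegral.integral_add (kB_intervalIntegrable _ _ _ _) (kB_intervalIntegrable _ _ _ _)]
  rw [rhs]
  -- pointwise (a.e. in Q) comparison
  apply intervalIntegral.integral_congr; intro P hP
  rw [Set.uIcc_of_le hx.2] at hP
  have hP0 : 0 ≤ P := hx.1.trans hP.1
  apply intervalIntegral.integral_congr_ae
  have hfin : ({0, t₁ + P, t₂ + P, t₃ + P, t₄ + P} : Set ℝ).Finite := by
    simp only [Set.finite_insert, Set.finite_singleton]
  filter_upwards [hfin.countable.ae_notMem volume] with Q hQ hQm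
  rw [Set.uIoc_of_le hy.2] at hQm
  simp only [Set.mem_insert_iff, Set.mem_singleton_iff, not_or] at hQ
  obtain ⟨hQ0, hQ1, hQ2, hQ3, hQ4⟩ := hQ
  have hQpos : 0 < Q := lt_of_le_of_lt hy.1 hQm.1
  rw [kA_eq_kB ht₁ hP0 hQpos hQ1, kA_eq_kB ht₂ hP0 hQpos hQ2, kA_eq_kB ht₃ hP0 hQpos hQ3, kA_eq_kB ht₄ hP0 hQpos hQ4]

end qi2


/-! ## The mixture (Section 4.1, tex 187–189) — part 1: `f_c = ∫ f̃_r dm_c(r)` inside the convolution: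
`J_{c',d'}(s) = ∬ w_c(r) w_d(r') F̃_{r,r'}(s)` (and the `c' = 0` / `d' = 0` variants) -/

section mix1

/-- convolution over `p ∈ [-1,1]` [folklore] -/
noncomputable def conv (α β : ℝ → ℝ) (s : ℝ) : ℝ := ∫ p in (-1:ℝ)..1, α p * β (s - p)
/-- truncated odd monomial `q^{2c+1} 1[|q| ≤ 1]` [folklore] -/
noncomputable def monoT (c : ℕ) (q : ℝ) : ℝ := if |q| ≤ 1 then q ^ (2 * c + 1) else 0

/-- Auxiliary lemma `monoT_abs_le` of the Bui–Hall sign-conjecture leg (The mixture (Section 4.1, tex 187–189) — part 1: `f_c = ∫ f̃_r dm_c(r)` inside the convolution:); statement as displayed, box port verbatim. [cite: BuiHall2023, §1 Conjecture 1 — a step of THIS TREE's proof of it (box write-up paper-v3-d979a68f The mixture (Section 4.1; tex 187–189) — part 1: `f_c = ∫ f̃_r dm_c(r)); the cited paper states the conjecture and the proof is ours] -/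
theorem monoT_abs_le (c : ℕ) (q : ℝ) : |monoT c q| ≤ 1 := by
  unfold monoT; split_ifs with h
  · rw [abs_pow]; exact pow_le_one₀ (abs_nonneg _) h
  · simp

/-- Auxiliary lemma `monoT_measurable` of the Bui–Hall sign-conjecture leg (The mixture (Section 4.1, tex 187–189) — part 1: `f_c = ∫ f̃_r dm_c(r)` inside the convolution:); statement as displayed, box port verbatim. [cite: BuiHall2023, §1 Conjecture 1 — a step of THIS TREE's proof of it (box write-up paper-v3-d979a68f The mixture (Section 4.1; tex 187–189) — part 1: `f_c = ∫ f̃_r dm_c(r)); the cited paper states the conjecture and the proof is ours] -/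
theorem monoT_measurable (c : ℕ) : Measurable (monoT c) := by
  unfold monoT
  exact Measurable.ite (measurableSet_le continuous_abs.measurable measurable_const) (by fun_prop) measurable_const

/-- Auxiliary lemma `monoT_zero_eq_ft` of the Bui–Hall sign-conjecture leg (The mixture (Section 4.1, tex 187–189) — part 1: `f_c = ∫ f̃_r dm_c(r)` inside the convolution:); statement as displayed, box port verbatim. [cite: BuiHall2023, §1 Conjecture 1 — a step of THIS TREE's proof of it (box write-up paper-v3-d979a68f The mixture (Section 4.1; tex 187–189) — part 1: `f_c = ∫ f̃_r dm_c(r)); the cited paper states the conjecture and the proof is ours] -/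
theorem monoT_zero_eq_ft : monoT 0 = ft 0 := by
  ext q; unfold monoT ft
  simp only [Nat.mul_zero, Nat.zero_add, pow_one, abs_nonneg, true_and]

/-- `Jline c d = conv (monoT c) (monoT d)` [cite: BuiHall2023, §1 Conjecture 1 — a step of THIS TREE's proof of it (box write-up paper-v3-d979a68f The mixture (Section 4.1; tex 187–189) — part 1: `f_c = ∫ f̃_r dm_c(r)); the cited paper states the conjecture and the proof is ours] -/
theorem Jline_eq_conv (c d : ℕ) (s : ℝ) : Jline c d s = conv (monoT c) (monoT d) s := by
  unfold Jline conv
  apply intervalIntegral.integral_congr; intro p hp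
  rw [Set.uIcc_of_le (by norm_num)] at hp
  have hp1 : |p| ≤ 1 := abs_le.mpr ⟨hp.1, hp.2⟩
  simp only [monoT, if_pos hp1, abs_sub_comm p s]
  split_ifs <;> ring

/-- the mixture representation of the truncated odd monomial: `1[|p| ≤ 1] p^{2c+3} = ∫_0^1 w_c(r) f̃_r(p) dr` [cite: BuiHall2023, §1 Conjecture 1 — a step of THIS TREE's proof of it (box write-up paper-v3-d979a68f The mixture (Section 4.1; tex 187–189) — part 1: `f_c = ∫ f̃_r dm_c(r)); the cited paper states the conjecture and the proof is ours] -/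
theorem monoT_succ_eq_mixture (c : ℕ) (p : ℝ) : monoT (c + 1) p = ∫ r in (0:ℝ)..1, wN c r * ft r p := by
  unfold monoT
  by_cases hp : |p| ≤ 1
  · rw [if_pos hp]
    have habs : |p| ∈ Icc (0:ℝ) 1 := ⟨abs_nonneg _, hp⟩
    have e : ∀ r ∈ Set.uIcc (0:ℝ) 1, wN c r * ft r p = (if r ≤ |p| then wN c r else 0) * p := by
      intro r _; unfold ft; simp only [hp, and_true]; split_ifs <;> ring
    rw [intervalIntegral.integral_congr e, intervalIntegral.integral_mul_const, ← pow_as_integral c habs]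
    have : |p| ^ (2 * (c + 1)) = p ^ (2 * (c + 1)) := Even.pow_abs ⟨c + 1, by ring⟩ p
    rw [this]; ring
  · rw [if_neg hp]
    have e : ∀ r ∈ Set.uIcc (0:ℝ) 1, wN c r * ft r p = 0 := by
      intro r _; unfold ft; rw [if_neg (fun h => hp h.2)]; ring
    rw [intervalIntegral.integral_congr e]; simp

/-- joint measurability of `(r, p) ↦ f̃_r(p)` [cite: BuiHall2023, §1 Conjecture 1 — a step of THIS TREE's proof of it (box write-up paper-v3-d979a68f The mixture (Section 4.1; tex 187–189) — part 1: `f_c = ∫ f̃_r dm_c(r)); the cited paper states the conjecture and the proof is ours] -/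
theorem ft_measurable2 : Measurable (fun z : ℝ × ℝ => ft z.1 z.2) := by
  unfold ft
  refine Measurable.ite ?_ measurable_snd measurable_const
  have e : {z : ℝ × ℝ | z.1 ≤ |z.2| ∧ |z.2| ≤ 1} = {z : ℝ × ℝ | z.1 ≤ |z.2|} ∩ {z : ℝ × ℝ | |z.2| ≤ 1} := by
    ext z; simp
  rw [e]
  exact (measurableSet_le measurable_fst (by fun_prop)).inter (measurableSet_le (by fun_prop) measurable_const)

/-- Auxiliary lemma `wN_abs_le` of the Bui–Hall sign-conjecture leg (The mixture (Section 4.1, tex 187–189) — part 1: `f_c = ∫ f̃_r dm_c(r)` inside the convolution:); statement as displayed, box port verbatim. [cite: BuiHall2023, §1 Conjecture 1 — a step of THIS TREE's proof of it (box write-up paper-v3-d979a68f The mixture (Section 4.1; tex 187–189) — part 1: `f_c = ∫ f̃_r dm_c(r)); the cited paper states the conjecture and the proof is ours] -/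
theorem wN_abs_le (n : ℕ) {r : ℝ} (hr : r ∈ Icc (0:ℝ) 1) : |wN n r| ≤ 2 * ((n:ℝ) + 1) := by
  rw [abs_of_nonneg (wN_nonneg n hr.1)]; unfold wN
  have : r ^ (2 * n + 1) ≤ 1 := pow_le_one₀ hr.1 hr.2
  have h2 : (0:ℝ) ≤ 2 * ((n:ℝ) + 1) := by positivity
  nlinarith

/-- integrability on `[0,1]×[-1,1]`-type rectangles of a bounded-on-the-rectangle measurable kernel [cite: BuiHall2023, §1 Conjecture 1 — a step of THIS TREE's proof of it (box write-up paper-v3-d979a68f The mixture (Section 4.1; tex 187–189) — part 1: `f_c = ∫ f̃_r dm_c(r)); the cited paper states the conjecture and the proof is ours] -/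
theorem integrableOn_rect_of_bdd {K : ℝ × ℝ → ℝ} (hK : Measurable K) {a b a' b' C : ℝ}
    (hb : ∀ z ∈ Set.uIoc a b ×ˢ Set.uIoc a' b', |K z| ≤ C) : IntegrableOn K (Set.uIoc a b ×ˢ Set.uIoc a' b') := by
  have hR : MeasurableSet (Set.uIoc a b ×ˢ Set.uIoc a' b') := measurableSet_uIoc.prod measurableSet_uIoc
  have hvol : volume (Set.uIoc a b ×ˢ Set.uIoc a' b') ≠ ⊤ := by
    rw [Measure.volume_eq_prod, Measure.prod_prod]
    exact ENNReal.mul_ne_top (by rw [Set.uIoc, Real.volume_Ioc]; exact ENNReal.ofReal_ne_top)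
      (by rw [Set.uIoc, Real.volume_Ioc]; exact ENNReal.ofReal_ne_top)
  refine (integrableOn_const hvol (C := C)).mono' hK.aestronglyMeasurable ?_
  rw [MeasureTheory.ae_restrict_iff' hR]
  refine Filter.Eventually.of_forall fun z hz => ?_
  rw [Real.norm_eq_abs]; exact hb z hz

/-- mixing in the left slot: `conv (monoT (c+1)) β = ∫_0^1 w_c(r) conv (f̃_r) β dr` for bounded measurable `β` [cite: BuiHall2023, §1 Conjecture 1 — a step of THIS TREE's proof of it (box write-up paper-v3-d979a68f The mixture (Section 4.1; tex 187–189) — part 1: `f_c = ∫ f̃_r dm_c(r)); the cited paper states the conjecture and the proof is ours] -/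
theorem conv_mix_left (c : ℕ) {β : ℝ → ℝ} (hβm : Measurable β) (hβb : ∀ q, |β q| ≤ 1) (s : ℝ) :
    conv (monoT (c + 1)) β s = ∫ r in (0:ℝ)..1, wN c r * conv (ft r) β s := by
  unfold conv
  simp_rw [monoT_succ_eq_mixture, ← intervalIntegral.integral_mul_const]
  rw [MeasureTheory.intervalIntegral_intervalIntegral_swap]
  · apply intervalIntegral.integral_congr; intro r _
    simp only
    rw [← intervalIntegral.integral_const_mul]
    apply intervalIntegral.integral_congr; intro p _; simp only; ring
  · have : Function.uncurry (fun p r : ℝ => wN c r * ft r p * β (s - p))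
        = fun z : ℝ × ℝ => wN c z.2 * ft z.2 z.1 * β (s - z.1) := by ext ⟨p, r⟩; rfl
    rw [this]
    refine integrableOn_rect_of_bdd (C := 2 * ((c:ℝ) + 1)) ?_ ?_
    · exact (((wN_continuous c).measurable.comp measurable_snd).mul
        (ft_measurable2.comp (measurable_snd.prodMk measurable_fst))).mul
        (hβm.comp ((measurable_const (a := s)).sub measurable_fst))
    · rintro ⟨p, r⟩ ⟨_, hr⟩
      rw [Set.uIoc_of_le zero_le_one] at hr
      simp only [abs_mul]
      calc |wN c r| * |ft r p| * |β (s - p)| ≤ 2 * ((c:ℝ) + 1) * 1 * 1 := by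
            apply mul_le_mul (mul_le_mul (wN_abs_le c ⟨hr.1.le, hr.2⟩) (ft_abs_le _ _) (abs_nonneg _)
              (by positivity)) (hβb _) (abs_nonneg _) (by positivity)
        _ = 2 * ((c:ℝ) + 1) := by ring

/-- mixing in the right slot: `conv α (monoT (d+1)) = ∫_0^1 w_d(r') conv α (f̃_{r'}) dr'` for bounded measurable `α` [cite: BuiHall2023, §1 Conjecture 1 — a step of THIS TREE's proof of it (box write-up paper-v3-d979a68f The mixture (Section 4.1; tex 187–189) — part 1: `f_c = ∫ f̃_r dm_c(r)); the cited paper states the conjecture and the proof is ours] -/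
theorem conv_mix_right (d : ℕ) {α : ℝ → ℝ} (hαm : Measurable α) (hαb : ∀ q, |α q| ≤ 1) (s : ℝ) :
    conv α (monoT (d + 1)) s = ∫ r' in (0:ℝ)..1, wN d r' * conv α (ft r') s := by
  unfold conv
  simp_rw [monoT_succ_eq_mixture, ← intervalIntegral.integral_const_mul]
  rw [MeasureTheory.intervalIntegral_intervalIntegral_swap]
  · apply intervalIntegral.integral_congr; intro r' _
    simp only
    apply intervalIntegral.integral_congr; intro p _; simp only; ring
  · have : Function.uncurry (fun p r' : ℝ => α p * (wN d r' * ft r' (s - p)))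
        = fun z : ℝ × ℝ => α z.1 * (wN d z.2 * ft z.2 (s - z.1)) := by ext ⟨p, r'⟩; rfl
    rw [this]
    refine integrableOn_rect_of_bdd (C := 2 * ((d:ℝ) + 1)) ?_ ?_
    · exact (hαm.comp measurable_fst).mul (((wN_continuous d).measurable.comp measurable_snd).mul
        (ft_measurable2.comp (measurable_snd.prodMk ((measurable_const (a := s)).sub measurable_fst))))
    · rintro ⟨p, r'⟩ ⟨_, hr⟩
      rw [Set.uIoc_of_le zero_le_one] at hr
      simp only [abs_mul]
      calc |α p| * (|wN d r'| * |ft r' (s - p)|) ≤ 1 * (2 * ((d:ℝ) + 1) * 1) := by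
            apply mul_le_mul (hαb _) (mul_le_mul (wN_abs_le d ⟨hr.1.le, hr.2⟩) (ft_abs_le _ _) (abs_nonneg _)
              (by positivity)) (by positivity) zero_le_one
        _ = 2 * ((d:ℝ) + 1) := by ring

/-- Auxiliary lemma `JT_eq_conv` of the Bui–Hall sign-conjecture leg (The mixture (Section 4.1, tex 187–189) — part 1: `f_c = ∫ f̃_r dm_c(r)` inside the convolution:); statement as displayed, box port verbatim. [cite: BuiHall2023, §1 Conjecture 1 — a step of THIS TREE's proof of it (box write-up paper-v3-d979a68f The mixture (Section 4.1; tex 187–189) — part 1: `f_c = ∫ f̃_r dm_c(r)); the cited paper states the conjecture and the proof is ours] -/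
theorem JT_eq_conv (x y s : ℝ) : JT x y s = conv (ft x) (ft y) s := rfl

/-- the four mixture forms of `J = -h` in terms of `F̃_{r,r'} = JT r r'` [cite: BuiHall2023, §1 Conjecture 1 — a step of THIS TREE's proof of it (box write-up paper-v3-d979a68f The mixture (Section 4.1; tex 187–189) — part 1: `f_c = ∫ f̃_r dm_c(r)); the cited paper states the conjecture and the proof is ours] -/
theorem Jline_mix_00 (s : ℝ) : Jline 0 0 s = JT 0 0 s := by
  rw [Jline_eq_conv, monoT_zero_eq_ft, JT_eq_conv]

/-- Auxiliary lemma `Jline_mix_s0` of the Bui–Hall sign-conjecture leg (The mixture (Section 4.1, tex 187–189) — part 1: `f_c = ∫ f̃_r dm_c(r)` inside the convolution:); statement as displayed, box port verbatim. [cite: BuiHall2023, §1 Conjecture 1 — a step of THIS TREE's proof of it (box write-up paper-v3-d979a68f The mixture (Section 4.1; tex 187–189) — part 1: `f_c = ∫ f̃_r dm_c(r)); the cited paper states the conjecture and the proof is ours] -/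
theorem Jline_mix_s0 (c : ℕ) (s : ℝ) : Jline (c + 1) 0 s = ∫ r in (0:ℝ)..1, wN c r * JT r 0 s := by
  rw [Jline_eq_conv, monoT_zero_eq_ft, conv_mix_left c (ft_measurable 0) (ft_abs_le 0)]
  rfl

/-- Auxiliary lemma `Jline_mix_0s` of the Bui–Hall sign-conjecture leg (The mixture (Section 4.1, tex 187–189) — part 1: `f_c = ∫ f̃_r dm_c(r)` inside the convolution:); statement as displayed, box port verbatim. [cite: BuiHall2023, §1 Conjecture 1 — a step of THIS TREE's proof of it (box write-up paper-v3-d979a68f The mixture (Section 4.1; tex 187–189) — part 1: `f_c = ∫ f̃_r dm_c(r)); the cited paper states the conjecture and the proof is ours] -/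
theorem Jline_mix_0s (d : ℕ) (s : ℝ) : Jline 0 (d + 1) s = ∫ r' in (0:ℝ)..1, wN d r' * JT 0 r' s := by
  rw [Jline_eq_conv, monoT_zero_eq_ft, conv_mix_right d (ft_measurable 0) (ft_abs_le 0)]
  rfl

/-- Auxiliary lemma `Jline_mix_ss` of the Bui–Hall sign-conjecture leg (The mixture (Section 4.1, tex 187–189) — part 1: `f_c = ∫ f̃_r dm_c(r)` inside the convolution:); statement as displayed, box port verbatim. [cite: BuiHall2023, §1 Conjecture 1 — a step of THIS TREE's proof of it (box write-up paper-v3-d979a68f The mixture (Section 4.1; tex 187–189) — part 1: `f_c = ∫ f̃_r dm_c(r)); the cited paper states the conjecture and the proof is ours] -/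
theorem Jline_mix_ss (c d : ℕ) (s : ℝ) :
    Jline (c + 1) (d + 1) s = ∫ r in (0:ℝ)..1, wN c r * ∫ r' in (0:ℝ)..1, wN d r' * JT r r' s := by
  rw [Jline_eq_conv, conv_mix_left c (monoT_measurable _) (monoT_abs_le _)]
  apply intervalIntegral.integral_congr; intro r _
  simp only
  rw [conv_mix_right d (ft_measurable r) (ft_abs_le r)]
  rfl

end mix1


/-! ## The mixture — part 2: window integration, exchange with `dm_c ⊗ dm_d`, and `Mixture` PROVED -/

section mix2

/-- Auxiliary lemma `JT_abs_le` of the Bui–Hall sign-conjecture leg (The mixture — part 2: window integration, exchange with `dm_c ⊗ dm_d`, and `Mixture` PROVED); statement as displayed, box port verbatim. [cite: BuiHall2023, §1 Conjecture 1 — a step of THIS TREE's proof of it (box write-up paper-v3-d979a68f The mixture — part 2: window integration; exchange with `dm_c ⊗ dm_d`;); the cited paper states the conjecture and the proof is ours] -/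
theorem JT_abs_le (x y s : ℝ) : |JT x y s| ≤ 2 := by
  unfold JT
  have := intervalIntegral.norm_integral_le_of_norm_le_const (a := (-1:ℝ)) (b := 1) (C := (1:ℝ))
    (f := fun p => ft x p * ft y (s - p)) (fun p _ => by
      rw [Real.norm_eq_abs, abs_mul]
      calc |ft x p| * |ft y (s - p)| ≤ 1 * 1 := mul_le_mul (ft_abs_le _ _) (ft_abs_le _ _) (abs_nonneg _) zero_le_one
        _ = 1 := by ring)
  rw [Real.norm_eq_abs] at this
  norm_num at this
  linarith

/-- joint measurability of `(r, r', s) ↦ F̃_{r,r'}(s)` [cite: BuiHall2023, §1 Conjecture 1 — a step of THIS TREE's proof of it (box write-up paper-v3-d979a68f The mixture — part 2: window integration; exchange with `dm_c ⊗ dm_d`;); the cited paper states the conjecture and the proof is ours] -/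
theorem JT_measurable3 : Measurable (fun z : ℝ × ℝ × ℝ => JT z.1 z.2.1 z.2.2) := by
  have hK : Measurable (fun w : (ℝ × ℝ × ℝ) × ℝ => ft w.1.1 w.2 * ft w.1.2.1 (w.1.2.2 - w.2)) :=
    (ft_measurable2.comp ((measurable_fst.comp measurable_fst).prodMk measurable_snd)).mul
      (ft_measurable2.comp ((measurable_fst.comp (measurable_snd.comp measurable_fst)).prodMk
        ((measurable_snd.comp (measurable_snd.comp measurable_fst)).sub measurable_snd)))
  have e : (fun z : ℝ × ℝ × ℝ => JT z.1 z.2.1 z.2.2)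
      = fun z => ∫ p, ft z.1 p * ft z.2.1 (z.2.2 - p) ∂(volume.restrict (Ioc (-1) 1)) := by
    ext z; unfold JT; rw [intervalIntegral.integral_of_le (by norm_num)]
  rw [e]
  exact (hK.stronglyMeasurable.integral_prod_right').measurable

/-- weight × bounded measurable is interval integrable on `[0,1]` [cite: BuiHall2023, §1 Conjecture 1 — a step of THIS TREE's proof of it (box write-up paper-v3-d979a68f The mixture — part 2: window integration; exchange with `dm_c ⊗ dm_d`;); the cited paper states the conjecture and the proof is ours] -/
theorem ii_w (n : ℕ) {I : ℝ → ℝ} (hIm : Measurable I) {C : ℝ} (hIb : ∀ r, |I r| ≤ C) (a b : ℝ) :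
    IntervalIntegrable (fun r => wN n r * I r) volume a b := by
  have hc : Continuous fun r => wN n r * C := (wN_continuous n).mul continuous_const
  refine (hc.intervalIntegrable a b (μ := volume)).mono_fun
    (((wN_continuous n).measurable.mul hIm).aestronglyMeasurable) ?_
  refine Filter.Eventually.of_forall fun r => ?_
  show ‖wN n r * I r‖ ≤ ‖wN n r * C‖
  rw [Real.norm_eq_abs, Real.norm_eq_abs, abs_mul, abs_mul]
  exact mul_le_mul_of_nonneg_left ((hIb r).trans (le_abs_self C)) (abs_nonneg _)

/-- one exchange `∫_a^b ds ∫_0^1 w_n(r) K(r,s) dr = ∫_0^1 w_n(r) ∫_a^b K(r,s) ds dr` for a bounded measurable kernel [cite: BuiHall2023, §1 Conjecture 1 — a step of THIS TREE's proof of it (box write-up paper-v3-d979a68f The mixture — part 2: window integration; exchange with `dm_c ⊗ dm_d`;); the cited paper states the conjecture and the proof is ours] -/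
theorem window_exchange (n : ℕ) {K : ℝ → ℝ → ℝ} (hK : Measurable (Function.uncurry K)) {C : ℝ}
    (hb : ∀ r s, |K r s| ≤ C) (a b : ℝ) :
    ∫ s in a..b, ∫ r in (0:ℝ)..1, wN n r * K r s = ∫ r in (0:ℝ)..1, wN n r * ∫ s in a..b, K r s := by
  rw [MeasureTheory.intervalIntegral_intervalIntegral_swap]
  · apply intervalIntegral.integral_congr; intro r _
    simp only; rw [intervalIntegral.integral_const_mul]
  · have : Function.uncurry (fun s r : ℝ => wN n r * K r s) = fun z : ℝ × ℝ => wN n z.2 * K z.2 z.1 := by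
      ext ⟨s, r⟩; rfl
    rw [this]
    refine integrableOn_rect_of_bdd (C := 2 * ((n:ℝ) + 1) * |C|) ?_ ?_
    · exact ((wN_continuous n).measurable.comp measurable_snd).mul (hK.comp (measurable_snd.prodMk measurable_fst))
    · rintro ⟨s, r⟩ ⟨_, hr⟩
      rw [Set.uIoc_of_le zero_le_one] at hr
      simp only [abs_mul]
      exact mul_le_mul (wN_abs_le n ⟨hr.1.le, hr.2⟩) ((hb _ _).trans (le_abs_self C)) (abs_nonneg _) (by positivity)

/-- `Φ_r(s) := ∫_0^1 w_d(r') F̃_{r,r'}(s) dr'` is jointly measurable and bounded [cite: BuiHall2023, §1 Conjecture 1 — a step of THIS TREE's proof of it (box write-up paper-v3-d979a68f The mixture — part 2: window integration; exchange with `dm_c ⊗ dm_d`;); the cited paper states the conjecture and the proof is ours] -/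
theorem Phi_measurable (d : ℕ) :
    Measurable (Function.uncurry fun r s : ℝ => ∫ r' in (0:ℝ)..1, wN d r' * JT r r' s) := by
  have hK : Measurable (fun w : (ℝ × ℝ) × ℝ => wN d w.2 * JT w.1.1 w.2 w.1.2) :=
    ((wN_continuous d).measurable.comp measurable_snd).mul
      (JT_measurable3.comp ((measurable_fst.comp measurable_fst).prodMk
        (measurable_snd.prodMk (measurable_snd.comp measurable_fst))))
  have e : (Function.uncurry fun r s : ℝ => ∫ r' in (0:ℝ)..1, wN d r' * JT r r' s)
      = fun w : ℝ × ℝ => ∫ r', wN d r' * JT w.1 r' w.2 ∂(volume.restrict (Ioc 0 1)) := by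
    ext ⟨r, s⟩; simp only [Function.uncurry]; rw [intervalIntegral.integral_of_le zero_le_one]
  rw [e]
  exact (hK.stronglyMeasurable.integral_prod_right').measurable

/-- Auxiliary lemma `Phi_abs_le` of the Bui–Hall sign-conjecture leg (The mixture — part 2: window integration, exchange with `dm_c ⊗ dm_d`, and `Mixture` PROVED); statement as displayed, box port verbatim. [cite: BuiHall2023, §1 Conjecture 1 — a step of THIS TREE's proof of it (box write-up paper-v3-d979a68f The mixture — part 2: window integration; exchange with `dm_c ⊗ dm_d`;); the cited paper states the conjecture and the proof is ours] -/
theorem Phi_abs_le (d : ℕ) (r s : ℝ) : |∫ r' in (0:ℝ)..1, wN d r' * JT r r' s| ≤ 2 * ((d:ℝ) + 1) * 2 := by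
  have := intervalIntegral.norm_integral_le_of_norm_le_const (a := (0:ℝ)) (b := 1) (C := 2 * ((d:ℝ) + 1) * 2)
    (f := fun r' => wN d r' * JT r r' s) (fun r' hr => by
      rw [Set.uIoc_of_le zero_le_one] at hr
      rw [Real.norm_eq_abs, abs_mul]
      exact mul_le_mul (wN_abs_le d ⟨hr.1.le, hr.2⟩) (JT_abs_le _ _ _) (abs_nonneg _) (by positivity))
  rw [Real.norm_eq_abs] at this
  norm_num at this
  linarith

/-- Auxiliary lemma `window_abs_le` of the Bui–Hall sign-conjecture leg (The mixture — part 2: window integration, exchange with `dm_c ⊗ dm_d`, and `Mixture` PROVED); statement as displayed, box port verbatim. [cite: BuiHall2023, §1 Conjecture 1 — a step of THIS TREE's proof of it (box write-up paper-v3-d979a68f The mixture — part 2: window integration; exchange with `dm_c ⊗ dm_d`;); the cited paper states the conjecture and the proof is ours] -/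
theorem window_abs_le {K : ℝ → ℝ} {C : ℝ} (hb : ∀ s, |K s| ≤ C) (a b : ℝ) : |∫ s in a..b, K s| ≤ C * |b - a| := by
  have := intervalIntegral.norm_integral_le_of_norm_le_const (a := a) (b := b) (C := C) (f := K)
    (fun s _ => by rw [Real.norm_eq_abs]; exact hb s)
  rwa [Real.norm_eq_abs] at this

/-- measurability in `r'` (resp. `r`) of the window integral of `F̃` [cite: BuiHall2023, §1 Conjecture 1 — a step of THIS TREE's proof of it (box write-up paper-v3-d979a68f The mixture — part 2: window integration; exchange with `dm_c ⊗ dm_d`;); the cited paper states the conjecture and the proof is ours] -/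
theorem windowJT_measurable_snd (r a b : ℝ) : Measurable fun r' => ∫ s in a..b, JT r r' s := by
  have hK : Measurable (fun w : ℝ × ℝ => JT r w.1 w.2) :=
    JT_measurable3.comp (measurable_const.prodMk (measurable_fst.prodMk measurable_snd))
  rcases le_or_gt a b with hab | hab
  · have e : (fun r' => ∫ s in a..b, JT r r' s) = fun r' => ∫ s, JT r r' s ∂(volume.restrict (Ioc a b)) := by
      ext r'; rw [intervalIntegral.integral_of_le hab]
    rw [e]; exact (hK.stronglyMeasurable.integral_prod_right').measurable
  · have e : (fun r' => ∫ s in a..b, JT r r' s) = fun r' => -∫ s, JT r r' s ∂(volume.restrict (Ioc b a)) := by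
      ext r'; rw [intervalIntegral.integral_symm, intervalIntegral.integral_of_le hab.le]
    rw [e]; exact (hK.stronglyMeasurable.integral_prod_right').measurable.neg

/-- Auxiliary lemma `windowJT_measurable_fst` of the Bui–Hall sign-conjecture leg (The mixture — part 2: window integration, exchange with `dm_c ⊗ dm_d`, and `Mixture` PROVED); statement as displayed, box port verbatim. [cite: BuiHall2023, §1 Conjecture 1 — a step of THIS TREE's proof of it (box write-up paper-v3-d979a68f The mixture — part 2: window integration; exchange with `dm_c ⊗ dm_d`;); the cited paper states the conjecture and the proof is ours] -/
theorem windowJT_measurable_fst (r' a b : ℝ) : Measurable fun r => ∫ s in a..b, JT r r' s := by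
  have hK : Measurable (fun w : ℝ × ℝ => JT w.1 r' w.2) :=
    JT_measurable3.comp (measurable_fst.prodMk (measurable_const.prodMk measurable_snd))
  rcases le_or_gt a b with hab | hab
  · have e : (fun r => ∫ s in a..b, JT r r' s) = fun r => ∫ s, JT r r' s ∂(volume.restrict (Ioc a b)) := by
      ext r; rw [intervalIntegral.integral_of_le hab]
    rw [e]; exact (hK.stronglyMeasurable.integral_prod_right').measurable
  · have e : (fun r => ∫ s in a..b, JT r r' s) = fun r => -∫ s, JT r r' s ∂(volume.restrict (Ioc b a)) := by
      ext r; rw [intervalIntegral.integral_symm, intervalIntegral.integral_of_le hab.le]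
    rw [e]; exact (hK.stronglyMeasurable.integral_prod_right').measurable.neg

/-- the window integral of `J_{c+1,d+1}` as a double mixture of window integrals of `F̃` [cite: BuiHall2023, §1 Conjecture 1 — a step of THIS TREE's proof of it (box write-up paper-v3-d979a68f The mixture — part 2: window integration; exchange with `dm_c ⊗ dm_d`;); the cited paper states the conjecture and the proof is ours] -/
theorem window_mix_ss (c d : ℕ) (a b : ℝ) :
    ∫ s in a..b, Jline (c + 1) (d + 1) s
      = ∫ r in (0:ℝ)..1, wN c r * ∫ r' in (0:ℝ)..1, wN d r' * ∫ s in a..b, JT r r' s := by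
  simp_rw [Jline_mix_ss]
  rw [window_exchange c (Phi_measurable d) (Phi_abs_le d) a b]
  apply intervalIntegral.integral_congr; intro r _
  simp only
  congr 1
  exact window_exchange d (K := fun r' s => JT r r' s)
    (JT_measurable3.comp (measurable_const.prodMk (measurable_fst.prodMk measurable_snd))) (fun r' s => JT_abs_le r r' s) a b

/-- Auxiliary lemma `window_mix_s0` of the Bui–Hall sign-conjecture leg (The mixture — part 2: window integration, exchange with `dm_c ⊗ dm_d`, and `Mixture` PROVED); statement as displayed, box port verbatim. [cite: BuiHall2023, §1 Conjecture 1 — a step of THIS TREE's proof of it (box write-up paper-v3-d979a68f The mixture — part 2: window integration; exchange with `dm_c ⊗ dm_d`;); the cited paper states the conjecture and the proof is ours] -/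
theorem window_mix_s0 (c : ℕ) (a b : ℝ) :
    ∫ s in a..b, Jline (c + 1) 0 s = ∫ r in (0:ℝ)..1, wN c r * ∫ s in a..b, JT r 0 s := by
  simp_rw [Jline_mix_s0]
  exact window_exchange c (K := fun r s => JT r 0 s)
    (JT_measurable3.comp (measurable_fst.prodMk (measurable_const.prodMk measurable_snd))) (fun r s => JT_abs_le r 0 s) a b

/-- Auxiliary lemma `window_mix_0s` of the Bui–Hall sign-conjecture leg (The mixture — part 2: window integration, exchange with `dm_c ⊗ dm_d`, and `Mixture` PROVED); statement as displayed, box port verbatim. [cite: BuiHall2023, §1 Conjecture 1 — a step of THIS TREE's proof of it (box write-up paper-v3-d979a68f The mixture — part 2: window integration; exchange with `dm_c ⊗ dm_d`;); the cited paper states the conjecture and the proof is ours] -/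
theorem window_mix_0s (d : ℕ) (a b : ℝ) :
    ∫ s in a..b, Jline 0 (d + 1) s = ∫ r' in (0:ℝ)..1, wN d r' * ∫ s in a..b, JT 0 r' s := by
  simp_rw [Jline_mix_0s]
  exact window_exchange d (K := fun r' s => JT 0 r' s)
    (JT_measurable3.comp (measurable_const.prodMk (measurable_fst.prodMk measurable_snd))) (fun r' s => JT_abs_le 0 r' s) a b

/-- `Λ_{c,d}` through `J`: `LamCD c d u v = ∫_{v-u}^{1-u} J + ∫_{u+v}^{1+u} J` on the triangle [cite: BuiHall2023, §1 Conjecture 1 — a step of THIS TREE's proof of it (box write-up paper-v3-d979a68f The mixture — part 2: window integration; exchange with `dm_c ⊗ dm_d`;); the cited paper states the conjecture and the proof is ours] -/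
theorem LamCD_eq_Jline (c d : ℕ) {u v : ℝ} (hv : 0 ≤ v) (hvu : v ≤ u) (hu : u ≤ 1) :
    LamCD c d u v = (∫ s in (v - u)..(1 - u), Jline c d s) + ∫ s in (u + v)..(1 + u), Jline c d s := by
  unfold LamCD
  congr 1
  · apply intervalIntegral.integral_congr; intro s hs
    rw [Set.uIcc_of_le (by linarith)] at hs
    exact (Jline_eq c d (abs_le.mpr ⟨by linarith [hs.1], by linarith [hs.2]⟩)).symm
  · apply intervalIntegral.integral_congr; intro s hs
    rw [Set.uIcc_of_le (by linarith)] at hs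
    exact (Jline_eq c d (abs_le.mpr ⟨by linarith [hs.1], by linarith [hs.2]⟩)).symm

/-- **The mixture representation `Mixture` (Section 4.1: tex 187–189 + Lemma QI + eq. (LamN) + eq. (prims)), PROVED.** [cite: BuiHall2023, §1 Conjecture 1 — a step of THIS TREE's proof of it (box write-up paper-v3-d979a68f The mixture — part 2: window integration; exchange with `dm_c ⊗ dm_d`;); the cited paper states the conjecture and the proof is ours] -/
theorem mixture_holds : Mixture := by
  refine ⟨?_, ?_, ?_, ?_⟩
  · -- (0,0)
    intro u v hv hvu hu
    rw [LamCD_eq_Jline 0 0 hv hvu hu]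
    simp_rw [Jline_mix_00]
    exact core_QI hv hvu hu ⟨le_rfl, zero_le_one⟩ ⟨le_rfl, zero_le_one⟩
  · -- (c+1, 0)
    intro c u v hv hvu hu
    rw [LamCD_eq_Jline _ _ hv hvu hu, window_mix_s0, window_mix_s0]
    have hI : ∀ a b : ℝ, IntervalIntegrable (fun r => wN c r * ∫ s in a..b, JT r 0 s) volume 0 1 := fun a b =>
      ii_w c (windowJT_measurable_fst 0 a b) (fun r => window_abs_le (fun s => JT_abs_le r 0 s) a b) 0 1
    rw [← intervalIntegral.integral_add (hI _ _) (hI _ _)]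
    apply intervalIntegral.integral_congr; intro r hr
    rw [Set.uIcc_of_le zero_le_one] at hr
    show wN c r * (∫ s in (v - u)..(1 - u), JT r 0 s) + wN c r * (∫ s in (u + v)..(1 + u), JT r 0 s)
      = 2 * ((c:ℝ) + 1) * r ^ (2 * c + 1) * Lam u v r 0
    rw [← mul_add, core_QI hv hvu hu hr ⟨le_rfl, zero_le_one⟩]; rfl
  · -- (0, d+1)
    intro d u v hv hvu hu
    rw [LamCD_eq_Jline _ _ hv hvu hu, window_mix_0s, window_mix_0s]
    have hI : ∀ a b : ℝ, IntervalIntegrable (fun r' => wN d r' * ∫ s in a..b, JT 0 r' s) volume 0 1 := fun a b =>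
      ii_w d (windowJT_measurable_snd 0 a b) (fun r' => window_abs_le (fun s => JT_abs_le 0 r' s) a b) 0 1
    rw [← intervalIntegral.integral_add (hI _ _) (hI _ _)]
    apply intervalIntegral.integral_congr; intro r' hr
    rw [Set.uIcc_of_le zero_le_one] at hr
    show wN d r' * (∫ s in (v - u)..(1 - u), JT 0 r' s) + wN d r' * (∫ s in (u + v)..(1 + u), JT 0 r' s)
      = 2 * ((d:ℝ) + 1) * r' ^ (2 * d + 1) * Lam u v 0 r'
    rw [← mul_add, core_QI hv hvu hu ⟨le_rfl, zero_le_one⟩ hr]; rfl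
  · -- (c+1, d+1)
    intro c d u v hv hvu hu
    rw [LamCD_eq_Jline _ _ hv hvu hu, window_mix_ss, window_mix_ss]
    -- outer combination
    have hIm : ∀ a b : ℝ, Measurable fun r => ∫ r' in (0:ℝ)..1, wN d r' * ∫ s in a..b, JT r r' s := by
      intro a b
      have hK : Measurable (fun w : ℝ × ℝ => wN d w.2 * ∫ s in a..b, JT w.1 w.2 s) := by
        refine ((wN_continuous d).measurable.comp measurable_snd).mul ?_
        -- (r, r') ↦ ∫_a^b JT r r' s
        have hK3 : Measurable (fun w : (ℝ × ℝ) × ℝ => JT w.1.1 w.1.2 w.2) :=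
          JT_measurable3.comp ((measurable_fst.comp measurable_fst).prodMk
            ((measurable_snd.comp measurable_fst).prodMk measurable_snd))
        rcases le_or_gt a b with hab | hab
        · have e : (fun w : ℝ × ℝ => ∫ s in a..b, JT w.1 w.2 s) = fun w => ∫ s, JT w.1 w.2 s ∂(volume.restrict (Ioc a b)) := by
            ext w; rw [intervalIntegral.integral_of_le hab]
          rw [e]; exact (hK3.stronglyMeasurable.integral_prod_right').measurable
        · have e : (fun w : ℝ × ℝ => ∫ s in a..b, JT w.1 w.2 s)
              = fun w => -∫ s, JT w.1 w.2 s ∂(volume.restrict (Ioc b a)) := by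
            ext w; rw [intervalIntegral.integral_symm, intervalIntegral.integral_of_le hab.le]
          rw [e]; exact (hK3.stronglyMeasurable.integral_prod_right').measurable.neg
      have e : (fun r => ∫ r' in (0:ℝ)..1, wN d r' * ∫ s in a..b, JT r r' s)
          = fun r => ∫ r', (wN d r' * ∫ s in a..b, JT r r' s) ∂(volume.restrict (Ioc 0 1)) := by
        ext r; rw [intervalIntegral.integral_of_le zero_le_one]
      rw [e]; exact (hK.stronglyMeasurable.integral_prod_right').measurable
    have hIb : ∀ a b : ℝ, |b - a| ≤ 2 → ∀ r, |∫ r' in (0:ℝ)..1, wN d r' * ∫ s in a..b, JT r r' s| ≤ 2 * ((d:ℝ) + 1) * 4 := by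
      intro a b hab r
      have := intervalIntegral.norm_integral_le_of_norm_le_const (a := (0:ℝ)) (b := 1) (C := 2 * ((d:ℝ) + 1) * 4)
        (f := fun r' => wN d r' * ∫ s in a..b, JT r r' s) (fun r' hr => by
          rw [Set.uIoc_of_le zero_le_one] at hr
          rw [Real.norm_eq_abs, abs_mul]
          refine mul_le_mul (wN_abs_le d ⟨hr.1.le, hr.2⟩) ?_ (abs_nonneg _) (by positivity)
          have := window_abs_le (fun s => JT_abs_le r r' s) a b
          nlinarith [abs_nonneg (b - a)])
      rw [Real.norm_eq_abs] at this
      norm_num at this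
      linarith
    have hI : ∀ a b : ℝ, |b - a| ≤ 2 →
        IntervalIntegrable (fun r => wN c r * ∫ r' in (0:ℝ)..1, wN d r' * ∫ s in a..b, JT r r' s) volume 0 1 :=
      fun a b hab => ii_w c (hIm a b) (hIb a b hab) 0 1
    rw [← intervalIntegral.integral_add (hI _ _ (by rw [abs_le]; constructor <;> linarith))
      (hI _ _ (by rw [abs_le]; constructor <;> linarith))]
    apply intervalIntegral.integral_congr; intro r hr
    rw [Set.uIcc_of_le zero_le_one] at hr
    show wN c r * (∫ r' in (0:ℝ)..1, wN d r' * ∫ s in (v - u)..(1 - u), JT r r' s)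
        + wN c r * (∫ r' in (0:ℝ)..1, wN d r' * ∫ s in (u + v)..(1 + u), JT r r' s)
      = 2 * ((c:ℝ) + 1) * r ^ (2 * c + 1) * ∫ r' in (0:ℝ)..1, 2 * ((d:ℝ) + 1) * r' ^ (2 * d + 1) * Lam u v r r'
    rw [← mul_add]
    -- inner combination
    have hJ : ∀ a b : ℝ, IntervalIntegrable (fun r' => wN d r' * ∫ s in a..b, JT r r' s) volume 0 1 := fun a b =>
      ii_w d (windowJT_measurable_snd r a b) (fun r' => window_abs_le (fun s => JT_abs_le r r' s) a b) 0 1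
    rw [← intervalIntegral.integral_add (hJ _ _) (hJ _ _)]
    have e : ∀ r' ∈ Set.uIcc (0:ℝ) 1, wN d r' * (∫ s in (v - u)..(1 - u), JT r r' s) + wN d r' * (∫ s in (u + v)..(1 + u), JT r r' s)
        = 2 * ((d:ℝ) + 1) * r' ^ (2 * d + 1) * Lam u v r r' := by
      intro r' hr'
      rw [Set.uIcc_of_le zero_le_one] at hr'
      rw [← mul_add, core_QI hv hvu hu hr hr']; rfl
    rw [intervalIntegral.integral_congr e]
    rfl

end mix2


/-! ## Theorem structure, Step 3 (tex 116–118): the layer-cake/scaling identity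
`∫_{Σξ=0} ξ^k (½ − ‖ξ‖_∞)_+ dξ = 2^{-K-4}/(K+4) · ∫_Q η^k` — toward G1 (scratch, v3) -/

section struct3
variable (k₁ k₂ k₃ k₄ : ℕ)

/-- the cube-and-slab integral at scale `ρ`: `∫_{[-ρ,ρ]³} 1[|a+b+e| ≤ ρ] a^{k₁} b^{k₂} e^{k₃} (−a−b−e)^{k₄}` [folklore] -/
noncomputable def cubeInt (ρ : ℝ) : ℝ :=
  ∫ a in (-ρ)..ρ, ∫ b in (-ρ)..ρ, ∫ e in (-ρ)..ρ,
    (if |a + b + e| ≤ ρ then a ^ k₁ * b ^ k₂ * e ^ k₃ * (-a - b - e) ^ k₄ else 0)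

/-- scaling: `cubeInt ρ = ρ^{K+3} ∫_Q η^k` for `ρ > 0` [cite: BuiHall2023, §1 Conjecture 1 — a step of THIS TREE's proof of it (box write-up paper-v3-d979a68f Theorem structure; Step 3 (tex 116–118): the layer-cake/scaling identi); the cited paper states the conjecture and the proof is ours] -/
theorem cubeInt_eq (ρ : ℝ) (hρ : 0 < ρ) :
    cubeInt k₁ k₂ k₃ k₄ ρ = ρ ^ (k₁ + k₂ + k₃ + k₄ + 3) * intQ (fun a b e f => a ^ k₁ * b ^ k₂ * e ^ k₃ * f ^ k₄) := by
  unfold cubeInt intQ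
  have hρ0 : ρ ≠ 0 := hρ.ne'
  -- scale a
  have sA : ∀ (F : ℝ → ℝ), ∫ a in (-ρ)..ρ, F a = ρ * ∫ a in (-1:ℝ)..1, F (ρ * a) := by
    intro F
    have := intervalIntegral.smul_integral_comp_mul_left F ρ (a := -1) (b := 1)
    rw [mul_neg_one, mul_one] at this
    rw [← this, smul_eq_mul]
  rw [sA]
  simp_rw [sA (fun b => ∫ e in (-ρ)..ρ, _)]
  conv_lhs => arg 2; arg 1; intro a; arg 2; arg 1; intro b; rw [sA]
  -- now everything is over [-1,1]³ with arguments ρa, ρb, ρe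
  have inner : ∀ a b e : ℝ,
      (if |ρ * a + ρ * b + ρ * e| ≤ ρ then (ρ * a) ^ k₁ * (ρ * b) ^ k₂ * (ρ * e) ^ k₃ * (-(ρ * a) - ρ * b - ρ * e) ^ k₄ else 0)
        = ρ ^ (k₁ + k₂ + k₃ + k₄) * (if |a + b + e| ≤ 1 then a ^ k₁ * b ^ k₂ * e ^ k₃ * (-a - b - e) ^ k₄ else 0) := by
    intro a b e
    have habs : |ρ * a + ρ * b + ρ * e| = ρ * |a + b + e| := by
      rw [show ρ * a + ρ * b + ρ * e = ρ * (a + b + e) by ring, abs_mul, abs_of_pos hρ]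
    have hiff : (|ρ * a + ρ * b + ρ * e| ≤ ρ) ↔ (|a + b + e| ≤ 1) := by
      rw [habs]; constructor
      · intro h; nlinarith [abs_nonneg (a + b + e)]
      · intro h; nlinarith [abs_nonneg (a + b + e)]
    simp only [hiff]
    split_ifs
    · rw [show -(ρ * a) - ρ * b - ρ * e = ρ * (-a - b - e) by ring, mul_pow, mul_pow, mul_pow, mul_pow]; ring
    · ring
  simp_rw [inner, intervalIntegral.integral_const_mul]
  ring

end struct3


/-! ## Theorem structure, Step 1 (tex 99–107): `HARDY` through the oriented integrals `J_{k,ℓ}(v₁,v₂)` (scratch, v3) -/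

section struct1

/-- `J_{k,ℓ}(v₁,v₂) := ∫_{v₁}^{v₂} s^k (v₁+v₂−s)^ℓ ds` (oriented) [folklore] -/
noncomputable def Jkl (k l : ℕ) (v₁ v₂ : ℝ) : ℝ := ∫ s in v₁..v₂, s ^ k * (v₁ + v₂ - s) ^ l

/-- the `u₃`-integral: `(v₂−v₁) ∫_0^1 s(u)^k (σ − s(u))^ℓ du = J_{k,ℓ}(v₁,v₂)`, `s(u) = v₁ + (v₂−v₁)u` (also when `v₁ = v₂`) [cite: BuiHall2023, §1 Conjecture 1 — a step of THIS TREE's proof of it (box write-up paper-v3-d979a68f Theorem structure; Step 1 (tex 99–107): `HARDY` through the oriented i); the cited paper states the conjecture and the proof is ours] -/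
theorem lineJ (k l : ℕ) (v₁ v₂ : ℝ) :
    (v₂ - v₁) * ∫ u in (0:ℝ)..1, (v₁ + (v₂ - v₁) * u) ^ k * (v₂ - (v₂ - v₁) * u) ^ l = Jkl k l v₁ v₂ := by
  unfold Jkl
  have h := intervalIntegral.smul_integral_comp_mul_add (fun s => s ^ k * (v₁ + v₂ - s) ^ l) (v₂ - v₁) v₁ (a := 0) (b := 1)
  simp only [mul_zero, zero_add, mul_one, sub_add_cancel, smul_eq_mul] at h
  rw [← h]
  congr 1
  apply intervalIntegral.integral_congr; intro u _
  simp only; ring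

/-- Step 1: `bhInt k ℓ m n = 3 ∫_{[-½,½]²} J_{k,ℓ} J_{m,n}` [cite: BuiHall2023, §1 Conjecture 1 — a step of THIS TREE's proof of it (box write-up paper-v3-d979a68f Theorem structure; Step 1 (tex 99–107): `HARDY` through the oriented i); the cited paper states the conjecture and the proof is ours] -/
theorem bhInt_eq_JJ (k l m n : ℕ) :
    bhInt k l m n = 3 * ∫ v₁ in (-(1/2:ℝ))..(1/2), ∫ v₂ in (-(1/2:ℝ))..(1/2), Jkl k l v₁ v₂ * Jkl m n v₁ v₂ := by
  unfold bhInt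
  congr 1
  -- u₁ ↦ v₁ = ½ − u₁, u₂ ↦ v₂ = ½ − u₂
  have sub1 : ∀ (F : ℝ → ℝ), ∫ u in (0:ℝ)..1, F u = ∫ v in (-(1/2:ℝ))..(1/2), F (1/2 - v) := by
    intro F
    rw [intervalIntegral.integral_comp_sub_left (fun u => F u) (1/2)]
    norm_num
  rw [sub1]
  apply intervalIntegral.integral_congr; intro v₁ _
  simp only
  rw [sub1]
  apply intervalIntegral.integral_congr; intro v₂ _
  simp only
  -- the two inner integrals factor
  have e3 : ∀ u3 : ℝ, ∫ u4 in (0:ℝ)..1,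
      (1/2 - v₁ - (1/2 - v₂)) ^ 2 * (1/2 + (1/2 - v₁ - (1/2 - v₂)) * u3 - (1/2 - v₁)) ^ k
        * (1/2 + (1/2 - v₂ - (1/2 - v₁)) * u3 - (1/2 - v₂)) ^ l
        * (1/2 + (1/2 - v₁ - (1/2 - v₂)) * u4 - (1/2 - v₁)) ^ m * (1/2 + (1/2 - v₂ - (1/2 - v₁)) * u4 - (1/2 - v₂)) ^ n
      = ((v₂ - v₁) * ((v₁ + (v₂ - v₁) * u3) ^ k * (v₂ - (v₂ - v₁) * u3) ^ l))
        * ((v₂ - v₁) * ∫ u4 in (0:ℝ)..1, (v₁ + (v₂ - v₁) * u4) ^ m * (v₂ - (v₂ - v₁) * u4) ^ n) := by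
    intro u3
    rw [← mul_assoc, ← intervalIntegral.integral_const_mul]
    apply intervalIntegral.integral_congr; intro u4 _
    simp only; ring
  simp_rw [e3]
  rw [intervalIntegral.integral_mul_const, intervalIntegral.integral_const_mul, lineJ, lineJ]

end struct1

/-! ## Theorem structure, Step 2 (2f): the fibre length is `½ − ‖ξ‖_∞` EXACTLY on the hyperplane (scratch, v3) -/

section struct2f

/-- with `ξ₄ = −(ξ₁+ξ₂+ξ₃)`: `min(ξ₁,ξ₂,−ξ₃,−ξ₄) − max(−½, ξ₁+ξ₂−½) = ½ − max_j |ξ_j|` [cite: BuiHall2023, §1 Conjecture 1 — a step of THIS TREE's proof of it (box write-up paper-v3-d979a68f Theorem structure; Step 2 (2f): the fibre length is `½ − ‖ξ‖_∞` EXACTL); the cited paper states the conjecture and the proof is ours] -/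
theorem fibre_len_eq (ξ₁ ξ₂ ξ₃ : ℝ) :
    min (min ξ₁ ξ₂) (min (-ξ₃) (ξ₁ + ξ₂ + ξ₃)) - max (-(1/2 : ℝ)) (ξ₁ + ξ₂ - 1/2)
      = 1/2 - max (max |ξ₁| |ξ₂|) (max |ξ₃| |ξ₁ + ξ₂ + ξ₃|) := by
  set mn := min (min ξ₁ ξ₂) (min (-ξ₃) (ξ₁ + ξ₂ + ξ₃)) with hmn
  set mx := max (-(1/2 : ℝ)) (ξ₁ + ξ₂ - 1/2) with hmx
  set M := max (max |ξ₁| |ξ₂|) (max |ξ₃| |ξ₁ + ξ₂ + ξ₃|) with hM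
  have m1 : mn ≤ ξ₁ := (min_le_left _ _).trans (min_le_left _ _)
  have m2 : mn ≤ ξ₂ := (min_le_left _ _).trans (min_le_right _ _)
  have m3 : mn ≤ -ξ₃ := (min_le_right _ _).trans (min_le_left _ _)
  have m4 : mn ≤ ξ₁ + ξ₂ + ξ₃ := (min_le_right _ _).trans (min_le_right _ _)
  have x1 : -(1/2 : ℝ) ≤ mx := le_max_left _ _
  have x2 : ξ₁ + ξ₂ - 1/2 ≤ mx := le_max_right _ _
  have a1 : |ξ₁| ≤ M := (le_max_left _ _).trans (le_max_left _ _)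
  have a2 : |ξ₂| ≤ M := (le_max_right _ _).trans (le_max_left _ _)
  have a3 : |ξ₃| ≤ M := (le_max_left _ _).trans (le_max_right _ _)
  have a4 : |ξ₁ + ξ₂ + ξ₃| ≤ M := (le_max_right _ _).trans (le_max_right _ _)
  have b1 := abs_le.mp (a1); have b2 := abs_le.mp a2; have b3 := abs_le.mp a3; have b4 := abs_le.mp a4
  apply le_antisymm
  · -- mn - mx ≤ 1/2 - M  ⇔  M ≤ 1/2 - (mn - mx): each |ξ_j| ≤ that
    have hM : M ≤ 1/2 - (mn - mx) := by
      simp only [hM]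
      refine max_le (max_le ?_ ?_) (max_le ?_ ?_) <;> rw [abs_le] <;> constructor <;> linarith
    linarith
  · -- 1/2 - M ≤ mn - mx  ⇔  mn ≥ 1/2 - M + mx, by cases on mx and le_min
    have hmn : 1/2 - M + mx ≤ mn := by
      simp only [hmn]
      rcases le_total (-(1/2 : ℝ)) (ξ₁ + ξ₂ - 1/2) with h | h
      · have e : mx = ξ₁ + ξ₂ - 1/2 := max_eq_right h
        rw [e]
        refine le_min (le_min ?_ ?_) (le_min ?_ ?_) <;> linarith
      · have e : mx = -(1/2 : ℝ) := max_eq_left h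
        rw [e]
        refine le_min (le_min ?_ ?_) (le_min ?_ ?_) <;> linarith
    linarith

end struct2f

/-! ## Theorem structure, Step 2 (2e): the fibre integral, and a support/range lemma (scratch, v3) -/

section struct2e

/-- `∫_{-½}^{½} 1[L ≤ v ≤ U] dv = (U − L)₊` when `−½ ≤ L` and `U ≤ ½` [cite: BuiHall2023, §1 Conjecture 1 — a step of THIS TREE's proof of it (box write-up paper-v3-d979a68f Theorem structure; Step 2 (2e): the fibre integral; and a support/rang); the cited paper states the conjecture and the proof is ours] -/
theorem fibre_integral {L U : ℝ} (hL : -(1/2 : ℝ) ≤ L) (hU : U ≤ 1/2) :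
    ∫ v in (-(1/2 : ℝ))..(1/2), (if L ≤ v ∧ v ≤ U then (1:ℝ) else 0) = max (U - L) 0 := by
  have e : (fun v => if L ≤ v ∧ v ≤ U then (1:ℝ) else 0) = Set.indicator (Icc L U) (fun _ => (1:ℝ)) := by
    ext v; simp only [Set.indicator_apply, mem_Icc]
  rw [e, intervalIntegral.integral_of_le (by norm_num), setIntegral_indicator measurableSet_Icc,
    MeasureTheory.setIntegral_const, smul_eq_mul, mul_one]
  rcases le_or_gt L U with hLU | hLU
  · rw [max_eq_left (by linarith)]
    have hs : (Ioc (-(1/2 : ℝ)) (1/2) ∩ Icc L U : Set ℝ) =ᵐ[volume] (Icc L U : Set ℝ) := by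
      have h1 : (Ioc (-(1/2 : ℝ)) (1/2) ∩ Icc L U : Set ℝ) =ᵐ[volume] (Icc (-(1/2 : ℝ)) (1/2) ∩ Icc L U : Set ℝ) :=
        (Ioc_ae_eq_Icc (μ := volume)).inter (ae_eq_refl _)
      rw [Set.Icc_inter_Icc, max_eq_right hL, min_eq_right hU] at h1
      exact h1
    rw [Measure.real, measure_congr hs, Real.volume_Icc, ENNReal.toReal_ofReal (by linarith)]
  · rw [max_eq_right (by linarith), Set.Icc_eq_empty (by intro h; linarith), Set.inter_empty]
    simp

/-- integrals of a function vanishing outside `[-c, c]` do not see the range beyond `[-c, c]` [cite: BuiHall2023, §1 Conjecture 1 — a step of THIS TREE's proof of it (box write-up paper-v3-d979a68f Theorem structure; Step 2 (2e): the fibre integral; and a support/rang); the cited paper states the conjecture and the proof is ours] -/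
theorem integral_eq_of_vanish {f : ℝ → ℝ} {c : ℝ} (hc : 0 ≤ c) (hf : ∀ x, c < |x| → f x = 0)
    (hfi : ∀ p q, IntervalIntegrable f volume p q) {a b : ℝ} (ha : a ≤ -c) (hb : c ≤ b) :
    ∫ x in a..b, f x = ∫ x in (-c)..c, f x := by
  rw [← intervalIntegral.integral_add_adjacent_intervals (hfi a (-c)) (hfi (-c) b),
    ← intervalIntegral.integral_add_adjacent_intervals (hfi (-c) c) (hfi c b)]
  have z1 : ∫ x in a..(-c), f x = 0 := by
    rw [intervalIntegral.integral_of_le ha, integral_Ioc_eq_integral_Ioo]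
    exact MeasureTheory.setIntegral_eq_zero_of_forall_eq_zero fun x hx =>
      hf x (by rw [abs_of_neg (by linarith [hx.2])]; linarith [hx.2])
  have z2 : ∫ x in c..b, f x = 0 := by
    rw [intervalIntegral.integral_of_le hb]
    exact MeasureTheory.setIntegral_eq_zero_of_forall_eq_zero fun x hx =>
      hf x (by rw [abs_of_pos (by linarith [hx.1])]; exact hx.1)
  rw [z1, z2, zero_add, add_zero]

end struct2e

/-! ## Theorem structure, Step 3 (2h): layer cake `(½ − ‖ξ‖∞)₊ = ∫₀^{½} 1[‖ξ‖∞ ≤ ρ] dρ` and the cube cut (scratch, v3)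
(local copies `…'` of two integrability helpers from qi1/mix1 to keep this scratch self-contained) -/

section struct3b
variable (k₁ k₂ k₃ k₄ : ℕ)

/-- Auxiliary lemma `ii_of_bdd_meas'` of the Bui–Hall sign-conjecture leg (Theorem structure, Step 3 (2h): layer cake `(½ − ‖ξ‖∞)₊ = ∫₀^{½} 1[‖ξ‖∞ ≤ ρ] dρ` and the cube cut (scratch,…); statement as displayed, box port verbatim. [cite: BuiHall2023, §1 Conjecture 1 — a step of THIS TREE's proof of it (box write-up paper-v3-d979a68f Theorem structure; Step 3 (2h): layer cake `(½ − ‖ξ‖∞)₊ = ∫₀^{½} 1[‖ξ‖); the cited paper states the conjecture and the proof is ours] -/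
theorem ii_of_bdd_meas' {f : ℝ → ℝ} (hf : Measurable f) {C : ℝ} (hC : ∀ x, |f x| ≤ C) (a b : ℝ) :
    IntervalIntegrable f volume a b := by
  refine (intervalIntegrable_const (c := C)).mono_fun hf.aestronglyMeasurable ?_
  refine Filter.Eventually.of_forall fun x => ?_
  show ‖f x‖ ≤ ‖C‖
  rw [Real.norm_eq_abs, Real.norm_eq_abs]; exact (hC x).trans (le_abs_self C)

/-- Auxiliary lemma `integrableOn_rect_of_bdd'` of the Bui–Hall sign-conjecture leg (Theorem structure, Step 3 (2h): layer cake `(½ − ‖ξ‖∞)₊ = ∫₀^{½} 1[‖ξ‖∞ ≤ ρ] dρ` and the cube cut (scratch,…); statement as displayed, box port verbatim. [cite: BuiHall2023, §1 Conjecture 1 — a step of THIS TREE's proof of it (box write-up paper-v3-d979a68f Theorem structure; Step 3 (2h): layer cake `(½ − ‖ξ‖∞)₊ = ∫₀^{½} 1[‖ξ‖); the cited paper states the conjecture and the proof is ours] -/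
theorem integrableOn_rect_of_bdd' {K : ℝ × ℝ → ℝ} (hK : Measurable K) {a b a' b' C : ℝ}
    (hb : ∀ z ∈ Set.uIoc a b ×ˢ Set.uIoc a' b', |K z| ≤ C) : IntegrableOn K (Set.uIoc a b ×ˢ Set.uIoc a' b') := by
  have hR : MeasurableSet (Set.uIoc a b ×ˢ Set.uIoc a' b') := measurableSet_uIoc.prod measurableSet_uIoc
  have hvol : volume (Set.uIoc a b ×ˢ Set.uIoc a' b') ≠ ⊤ := by
    rw [Measure.volume_eq_prod, Measure.prod_prod]
    exact ENNReal.mul_ne_top (by rw [Set.uIoc, Real.volume_Ioc]; exact ENNReal.ofReal_ne_top)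
      (by rw [Set.uIoc, Real.volume_Ioc]; exact ENNReal.ofReal_ne_top)
  refine (integrableOn_const hvol (C := C)).mono' hK.aestronglyMeasurable ?_
  rw [MeasureTheory.ae_restrict_iff' hR]
  refine Filter.Eventually.of_forall fun z hz => ?_
  rw [Real.norm_eq_abs]; exact hb z hz

/-- `‖ξ‖_∞` for `ξ = (a, b, e, −a−b−e)` [folklore] -/
noncomputable def supN (a b e : ℝ) : ℝ := max (max |a| |b|) (max |e| |a + b + e|)

/-- Auxiliary lemma `supN_nonneg` of the Bui–Hall sign-conjecture leg (Theorem structure, Step 3 (2h): layer cake `(½ − ‖ξ‖∞)₊ = ∫₀^{½} 1[‖ξ‖∞ ≤ ρ] dρ` and the cube cut (scratch,…); statement as displayed, box port verbatim. [cite: BuiHall2023, §1 Conjecture 1 — a step of THIS TREE's proof of it (box write-up paper-v3-d979a68f Theorem structure; Step 3 (2h): layer cake `(½ − ‖ξ‖∞)₊ = ∫₀^{½} 1[‖ξ‖); the cited paper states the conjecture and the proof is ours] -/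
theorem supN_nonneg (a b e : ℝ) : 0 ≤ supN a b e := (abs_nonneg a).trans ((le_max_left _ _).trans (le_max_left _ _))

/-- Auxiliary lemma `supN_continuous` of the Bui–Hall sign-conjecture leg (Theorem structure, Step 3 (2h): layer cake `(½ − ‖ξ‖∞)₊ = ∫₀^{½} 1[‖ξ‖∞ ≤ ρ] dρ` and the cube cut (scratch,…); statement as displayed, box port verbatim. [cite: BuiHall2023, §1 Conjecture 1 — a step of THIS TREE's proof of it (box write-up paper-v3-d979a68f Theorem structure; Step 3 (2h): layer cake `(½ − ‖ξ‖∞)₊ = ∫₀^{½} 1[‖ξ‖); the cited paper states the conjecture and the proof is ours] -/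
theorem supN_continuous : Continuous (fun z : ℝ × ℝ × ℝ => supN z.1 z.2.1 z.2.2) := by unfold supN; fun_prop

/-- layer cake for the tent: `(½ − m)₊ = ∫₀^{½} 1[m ≤ ρ] dρ` (`m ≥ 0`) [cite: BuiHall2023, §1 Conjecture 1 — a step of THIS TREE's proof of it (box write-up paper-v3-d979a68f Theorem structure; Step 3 (2h): layer cake `(½ − ‖ξ‖∞)₊ = ∫₀^{½} 1[‖ξ‖); the cited paper states the conjecture and the proof is ours] -/
theorem posPart_as_integral {m : ℝ} (hm : 0 ≤ m) :
    max (1/2 - m) 0 = ∫ ρ in (0:ℝ)..(1/2), (if m ≤ ρ then (1:ℝ) else 0) := by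
  rcases le_or_gt m (1/2) with h | h
  · have e : (fun ρ => if m ≤ ρ then (1:ℝ) else 0) = Set.indicator (Ici m) (fun _ => (1:ℝ)) := by
      ext ρ; simp only [Set.indicator_apply, mem_Ici]
    rw [e, max_eq_left (by linarith)]
    -- ∫_0^{1/2} 1_{[m,∞)} = ∫_m^{1/2} 1
    rw [integral_indicator_Ici (⟨hm, h⟩ : m ∈ Icc (0:ℝ) (1/2)), intervalIntegral.integral_const, smul_eq_mul, mul_one]
  · rw [max_eq_right (by linarith)]
    have e : ∀ ρ ∈ Set.uIcc (0:ℝ) (1/2), (if m ≤ ρ then (1:ℝ) else 0) = 0 := by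
      intro ρ hρ; rw [Set.uIcc_of_le (by norm_num)] at hρ; rw [if_neg (by linarith [hρ.2])]
    rw [intervalIntegral.integral_congr e]; simp

end struct3b

/-! ## Theorem structure, Step 3 assembled: `∫_{[-½,½]³} ξ^k (½ − ‖ξ‖∞)₊ = ∫₀^{½} cubeInt ρ dρ = intQ · 2^{-K-4}/(K+4)` (scratch, v3) -/

section struct3c
variable (k₁ k₂ k₃ k₄ : ℕ)

/-- the monomial `ξ^k` with `ξ₄ = −a−b−e` [folklore] -/
noncomputable def monoQ (a b e : ℝ) : ℝ := a ^ k₁ * b ^ k₂ * e ^ k₃ * (-a - b - e) ^ k₄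

/-- Auxiliary lemma `monoQ_continuous` of the Bui–Hall sign-conjecture leg (Theorem structure, Step 3 assembled: `∫_{[-½,½]³} ξ^k (½ − ‖ξ‖∞)₊ = ∫₀^{½} cubeInt ρ dρ = intQ · 2^{-K-4}/(…); statement as displayed, box port verbatim. [cite: BuiHall2023, §1 Conjecture 1 — a step of THIS TREE's proof of it (box write-up paper-v3-d979a68f Theorem structure; Step 3 assembled: `∫_{[-½;½]³} ξ^k (½ − ‖ξ‖∞)₊ = ∫₀); the cited paper states the conjecture and the proof is ours] -/
theorem monoQ_continuous : Continuous (fun z : ℝ × ℝ × ℝ => monoQ k₁ k₂ k₃ k₄ z.1 z.2.1 z.2.2) := by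
  unfold monoQ; fun_prop

/-- Auxiliary lemma `monoQ_abs_le` of the Bui–Hall sign-conjecture leg (Theorem structure, Step 3 assembled: `∫_{[-½,½]³} ξ^k (½ − ‖ξ‖∞)₊ = ∫₀^{½} cubeInt ρ dρ = intQ · 2^{-K-4}/(…); statement as displayed, box port verbatim. [cite: BuiHall2023, §1 Conjecture 1 — a step of THIS TREE's proof of it (box write-up paper-v3-d979a68f Theorem structure; Step 3 assembled: `∫_{[-½;½]³} ξ^k (½ − ‖ξ‖∞)₊ = ∫₀); the cited paper states the conjecture and the proof is ours] -/
theorem monoQ_abs_le {a b e : ℝ} (ha : |a| ≤ 1) (hb : |b| ≤ 1) (he : |e| ≤ 1) :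
    |monoQ k₁ k₂ k₃ k₄ a b e| ≤ 3 ^ (k₁ + k₂ + k₃ + k₄) := by
  unfold monoQ
  have h4 : |(-a - b - e)| ≤ 3 := by
    calc |(-a - b - e)| = |a + b + e| := by rw [show -a - b - e = -(a + b + e) by ring, abs_neg]
      _ ≤ |a| + |b| + |e| := (abs_add_le _ _).trans (add_le_add (abs_add_le _ _) le_rfl)
      _ ≤ 3 := by linarith
  rw [abs_mul, abs_mul, abs_mul, abs_pow, abs_pow, abs_pow, abs_pow]
  calc |a| ^ k₁ * |b| ^ k₂ * |e| ^ k₃ * |(-a - b - e)| ^ k₄ ≤ 3 ^ k₁ * 3 ^ k₂ * 3 ^ k₃ * 3 ^ k₄ := by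
        gcongr <;> linarith
    _ = 3 ^ (k₁ + k₂ + k₃ + k₄) := by rw [← pow_add, ← pow_add, ← pow_add]

/-- the layer-cake kernel `K = 1[‖ξ‖∞ ≤ ρ] ξ^k` [folklore] -/
noncomputable def Kten (a b e ρ : ℝ) : ℝ := if supN a b e ≤ ρ then monoQ k₁ k₂ k₃ k₄ a b e else 0

/-- Auxiliary lemma `Kten_measurable` of the Bui–Hall sign-conjecture leg (Theorem structure, Step 3 assembled: `∫_{[-½,½]³} ξ^k (½ − ‖ξ‖∞)₊ = ∫₀^{½} cubeInt ρ dρ = intQ · 2^{-K-4}/(…); statement as displayed, box port verbatim. [cite: BuiHall2023, §1 Conjecture 1 — a step of THIS TREE's proof of it (box write-up paper-v3-d979a68f Theorem structure; Step 3 assembled: `∫_{[-½;½]³} ξ^k (½ − ‖ξ‖∞)₊ = ∫₀); the cited paper states the conjecture and the proof is ours] -/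
theorem Kten_measurable : Measurable (fun w : (ℝ × ℝ × ℝ) × ℝ => Kten k₁ k₂ k₃ k₄ w.1.1 w.1.2.1 w.1.2.2 w.2) := by
  unfold Kten
  refine Measurable.ite ?_ ((monoQ_continuous k₁ k₂ k₃ k₄).measurable.comp measurable_fst) measurable_const
  exact measurableSet_le ((supN_continuous).measurable.comp measurable_fst) measurable_snd

/-- Auxiliary lemma `Kten_abs_le` of the Bui–Hall sign-conjecture leg (Theorem structure, Step 3 assembled: `∫_{[-½,½]³} ξ^k (½ − ‖ξ‖∞)₊ = ∫₀^{½} cubeInt ρ dρ = intQ · 2^{-K-4}/(…); statement as displayed, box port verbatim. [cite: BuiHall2023, §1 Conjecture 1 — a step of THIS TREE's proof of it (box write-up paper-v3-d979a68f Theorem structure; Step 3 assembled: `∫_{[-½;½]³} ξ^k (½ − ‖ξ‖∞)₊ = ∫₀); the cited paper states the conjecture and the proof is ours] -/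
theorem Kten_abs_le {a b e : ℝ} (ha : |a| ≤ 1) (hb : |b| ≤ 1) (he : |e| ≤ 1) (ρ : ℝ) :
    |Kten k₁ k₂ k₃ k₄ a b e ρ| ≤ 3 ^ (k₁ + k₂ + k₃ + k₄) := by
  unfold Kten; split_ifs
  · exact monoQ_abs_le k₁ k₂ k₃ k₄ ha hb he
  · simp

/-- Auxiliary lemma `abs_le_one_of_mem_uIoc_half` of the Bui–Hall sign-conjecture leg (Theorem structure, Step 3 assembled: `∫_{[-½,½]³} ξ^k (½ − ‖ξ‖∞)₊ = ∫₀^{½} cubeInt ρ dρ = intQ · 2^{-K-4}/(…); statement as displayed, box port verbatim. [cite: BuiHall2023, §1 Conjecture 1 — a step of THIS TREE's proof of it (box write-up paper-v3-d979a68f Theorem structure; Step 3 assembled: `∫_{[-½;½]³} ξ^k (½ − ‖ξ‖∞)₊ = ∫₀); the cited paper states the conjecture and the proof is ours] -/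
theorem abs_le_one_of_mem_uIoc_half {x : ℝ} (hx : x ∈ Set.uIoc (-(1/2 : ℝ)) (1/2)) : |x| ≤ 1 := by
  rw [Set.uIoc_of_le (by norm_num)] at hx; rw [abs_le]; constructor <;> linarith [hx.1, hx.2]

/-- Auxiliary lemma `abs_le_one_of_mem_uIcc_half` of the Bui–Hall sign-conjecture leg (Theorem structure, Step 3 assembled: `∫_{[-½,½]³} ξ^k (½ − ‖ξ‖∞)₊ = ∫₀^{½} cubeInt ρ dρ = intQ · 2^{-K-4}/(…); statement as displayed, box port verbatim. [cite: BuiHall2023, §1 Conjecture 1 — a step of THIS TREE's proof of it (box write-up paper-v3-d979a68f Theorem structure; Step 3 assembled: `∫_{[-½;½]³} ξ^k (½ − ‖ξ‖∞)₊ = ∫₀); the cited paper states the conjecture and the proof is ours] -/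
theorem abs_le_one_of_mem_uIcc_half {x : ℝ} (hx : x ∈ Set.uIcc (-(1/2 : ℝ)) (1/2)) : |x| ≤ 1 := by
  rw [Set.uIcc_of_le (by norm_num)] at hx; rw [abs_le]; constructor <;> linarith [hx.1, hx.2]

/-- step (i)+(ii): for fixed `a, b`: `∫_e ξ^k (½−‖ξ‖∞)₊ = ∫₀^{½} ∫_e K dρ` [cite: BuiHall2023, §1 Conjecture 1 — a step of THIS TREE's proof of it (box write-up paper-v3-d979a68f Theorem structure; Step 3 assembled: `∫_{[-½;½]³} ξ^k (½ − ‖ξ‖∞)₊ = ∫₀); the cited paper states the conjecture and the proof is ours] -/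
theorem tent_e (a b : ℝ) (ha : |a| ≤ 1) (hb : |b| ≤ 1) :
    ∫ e in (-(1/2 : ℝ))..(1/2), monoQ k₁ k₂ k₃ k₄ a b e * max (1/2 - supN a b e) 0
      = ∫ ρ in (0:ℝ)..(1/2), ∫ e in (-(1/2 : ℝ))..(1/2), Kten k₁ k₂ k₃ k₄ a b e ρ := by
  have e1 : ∀ e : ℝ, monoQ k₁ k₂ k₃ k₄ a b e * max (1/2 - supN a b e) 0 = ∫ ρ in (0:ℝ)..(1/2), Kten k₁ k₂ k₃ k₄ a b e ρ := by
    intro e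
    rw [posPart_as_integral (supN_nonneg a b e), ← intervalIntegral.integral_const_mul]
    apply intervalIntegral.integral_congr; intro ρ _
    unfold Kten; simp only; split_ifs <;> simp
  simp_rw [e1]
  rw [MeasureTheory.intervalIntegral_intervalIntegral_swap]
  have : Function.uncurry (fun e ρ : ℝ => Kten k₁ k₂ k₃ k₄ a b e ρ)
      = fun z : ℝ × ℝ => Kten k₁ k₂ k₃ k₄ a b z.1 z.2 := by ext ⟨e, ρ⟩; rfl
  rw [this]
  refine integrableOn_rect_of_bdd' (C := 3 ^ (k₁ + k₂ + k₃ + k₄)) ?_ ?_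
  · exact (Kten_measurable k₁ k₂ k₃ k₄).comp
      ((measurable_const.prodMk (measurable_const.prodMk measurable_fst)).prodMk measurable_snd)
  · rintro ⟨e, ρ⟩ ⟨he, _⟩
    exact Kten_abs_le k₁ k₂ k₃ k₄ ha hb (abs_le_one_of_mem_uIoc_half he) ρ

/-- step (iii): for fixed `a`: swap `b` past `ρ` [cite: BuiHall2023, §1 Conjecture 1 — a step of THIS TREE's proof of it (box write-up paper-v3-d979a68f Theorem structure; Step 3 assembled: `∫_{[-½;½]³} ξ^k (½ − ‖ξ‖∞)₊ = ∫₀); the cited paper states the conjecture and the proof is ours] -/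
theorem tent_b (a : ℝ) (ha : |a| ≤ 1) :
    ∫ b in (-(1/2 : ℝ))..(1/2), ∫ ρ in (0:ℝ)..(1/2), ∫ e in (-(1/2 : ℝ))..(1/2), Kten k₁ k₂ k₃ k₄ a b e ρ
      = ∫ ρ in (0:ℝ)..(1/2), ∫ b in (-(1/2 : ℝ))..(1/2), ∫ e in (-(1/2 : ℝ))..(1/2), Kten k₁ k₂ k₃ k₄ a b e ρ := by
  rw [MeasureTheory.intervalIntegral_intervalIntegral_swap]
  have hK : Measurable (fun w : (ℝ × ℝ) × ℝ => Kten k₁ k₂ k₃ k₄ a w.1.1 w.2 w.1.2) :=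
    (Kten_measurable k₁ k₂ k₃ k₄).comp
      ((measurable_const.prodMk ((measurable_fst.comp measurable_fst).prodMk measurable_snd)).prodMk
        (measurable_snd.comp measurable_fst))
  have e : Function.uncurry (fun b ρ : ℝ => ∫ e in (-(1/2 : ℝ))..(1/2), Kten k₁ k₂ k₃ k₄ a b e ρ)
      = fun w : ℝ × ℝ => ∫ e, Kten k₁ k₂ k₃ k₄ a w.1 e w.2 ∂(volume.restrict (Ioc (-(1/2 : ℝ)) (1/2))) := by
    ext ⟨b, ρ⟩; simp only [Function.uncurry]; rw [intervalIntegral.integral_of_le (by norm_num)]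
  rw [e]
  refine integrableOn_rect_of_bdd' (C := 3 ^ (k₁ + k₂ + k₃ + k₄) * 1) ?_ ?_
  · exact (hK.stronglyMeasurable.integral_prod_right').measurable
  · rintro ⟨b, ρ⟩ ⟨hb, _⟩
    simp only
    rw [← intervalIntegral.integral_of_le (by norm_num : (-(1/2 : ℝ)) ≤ 1/2)]
    have := intervalIntegral.norm_integral_le_of_norm_le_const (a := (-(1/2 : ℝ))) (b := 1/2)
      (C := 3 ^ (k₁ + k₂ + k₃ + k₄)) (f := fun e => Kten k₁ k₂ k₃ k₄ a b e ρ) (fun e he => by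
        rw [Real.norm_eq_abs]; exact Kten_abs_le k₁ k₂ k₃ k₄ ha (abs_le_one_of_mem_uIoc_half hb) (abs_le_one_of_mem_uIoc_half he) ρ)
    rw [Real.norm_eq_abs] at this
    norm_num at this
    linarith

/-- step (iv): swap `a` past `ρ` [cite: BuiHall2023, §1 Conjecture 1 — a step of THIS TREE's proof of it (box write-up paper-v3-d979a68f Theorem structure; Step 3 assembled: `∫_{[-½;½]³} ξ^k (½ − ‖ξ‖∞)₊ = ∫₀); the cited paper states the conjecture and the proof is ours] -/
theorem tent_a :
    ∫ a in (-(1/2 : ℝ))..(1/2), ∫ ρ in (0:ℝ)..(1/2), ∫ b in (-(1/2 : ℝ))..(1/2), ∫ e in (-(1/2 : ℝ))..(1/2), Kten k₁ k₂ k₃ k₄ a b e ρ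
      = ∫ ρ in (0:ℝ)..(1/2), ∫ a in (-(1/2 : ℝ))..(1/2), ∫ b in (-(1/2 : ℝ))..(1/2), ∫ e in (-(1/2 : ℝ))..(1/2),
          Kten k₁ k₂ k₃ k₄ a b e ρ := by
  rw [MeasureTheory.intervalIntegral_intervalIntegral_swap]
  -- kernel (((a,ρ),b),e) ↦ K a b e ρ
  have hK : Measurable (fun w : ((ℝ × ℝ) × ℝ) × ℝ => Kten k₁ k₂ k₃ k₄ w.1.1.1 w.1.2 w.2 w.1.1.2) :=
    (Kten_measurable k₁ k₂ k₃ k₄).comp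
      ((((measurable_fst.comp measurable_fst).comp measurable_fst).prodMk
        ((measurable_snd.comp measurable_fst).prodMk measurable_snd)).prodMk
        ((measurable_snd.comp measurable_fst).comp measurable_fst))
  have hInner : StronglyMeasurable (fun w : (ℝ × ℝ) × ℝ =>
      ∫ e, Kten k₁ k₂ k₃ k₄ w.1.1 w.2 e w.1.2 ∂(volume.restrict (Ioc (-(1/2 : ℝ)) (1/2)))) :=
    hK.stronglyMeasurable.integral_prod_right'
  have e : Function.uncurry (fun a ρ : ℝ => ∫ b in (-(1/2 : ℝ))..(1/2), ∫ e in (-(1/2 : ℝ))..(1/2), Kten k₁ k₂ k₃ k₄ a b e ρ)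
      = fun w : ℝ × ℝ => ∫ b, (∫ e, Kten k₁ k₂ k₃ k₄ w.1 b e w.2 ∂(volume.restrict (Ioc (-(1/2 : ℝ)) (1/2))))
          ∂(volume.restrict (Ioc (-(1/2 : ℝ)) (1/2))) := by
    ext ⟨a, ρ⟩; simp only [Function.uncurry]
    rw [intervalIntegral.integral_of_le (by norm_num)]
    congr 1; ext b; rw [intervalIntegral.integral_of_le (by norm_num)]
  rw [e]
  refine integrableOn_rect_of_bdd' (C := 3 ^ (k₁ + k₂ + k₃ + k₄) * 1 * 1) ?_ ?_
  · exact (hInner.integral_prod_right').measurable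
  · rintro ⟨a, ρ⟩ ⟨ha, _⟩
    have ha1 := abs_le_one_of_mem_uIoc_half ha
    simp only
    rw [← intervalIntegral.integral_of_le (by norm_num : (-(1/2 : ℝ)) ≤ 1/2)]
    have := intervalIntegral.norm_integral_le_of_norm_le_const (a := (-(1/2 : ℝ))) (b := 1/2)
      (C := 3 ^ (k₁ + k₂ + k₃ + k₄) * 1)
      (f := fun b => ∫ e, Kten k₁ k₂ k₃ k₄ a b e ρ ∂(volume.restrict (Ioc (-(1/2 : ℝ)) (1/2)))) (fun b hb => by
        rw [← intervalIntegral.integral_of_le (by norm_num : (-(1/2 : ℝ)) ≤ 1/2)]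
        have := intervalIntegral.norm_integral_le_of_norm_le_const (a := (-(1/2 : ℝ))) (b := 1/2)
          (C := 3 ^ (k₁ + k₂ + k₃ + k₄)) (f := fun e => Kten k₁ k₂ k₃ k₄ a b e ρ) (fun e he => by
            rw [Real.norm_eq_abs]
            exact Kten_abs_le k₁ k₂ k₃ k₄ ha1 (abs_le_one_of_mem_uIoc_half hb) (abs_le_one_of_mem_uIoc_half he) ρ)
        norm_num at this ⊢
        exact this)
    rw [Real.norm_eq_abs] at this
    norm_num at this ⊢
    linarith

end struct3c

section struct3d
variable (k₁ k₂ k₃ k₄ : ℕ)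

/-- Auxiliary lemma `supN_le_iff` of the Bui–Hall sign-conjecture leg (Theorem structure, Step 3 assembled: `∫_{[-½,½]³} ξ^k (½ − ‖ξ‖∞)₊ = ∫₀^{½} cubeInt ρ dρ = intQ · 2^{-K-4}/(…); statement as displayed, box port verbatim. [cite: BuiHall2023, §1 Conjecture 1 — a step of THIS TREE's proof of it (box write-up paper-v3-d979a68f Theorem structure; Step 3 assembled: `∫_{[-½;½]³} ξ^k (½ − ‖ξ‖∞)₊ = ∫₀); the cited paper states the conjecture and the proof is ours] -/
theorem supN_le_iff {a b e ρ : ℝ} : supN a b e ≤ ρ ↔ (|a| ≤ ρ ∧ |b| ≤ ρ) ∧ (|e| ≤ ρ ∧ |a + b + e| ≤ ρ) := by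
  unfold supN; rw [max_le_iff, max_le_iff, max_le_iff]

/-- the slab kernel at scale ρ (cubeInt's integrand) [folklore] -/
noncomputable def Kslab (ρ a b e : ℝ) : ℝ := if |a + b + e| ≤ ρ then monoQ k₁ k₂ k₃ k₄ a b e else 0

/-- Auxiliary lemma `Kslab_measurable` of the Bui–Hall sign-conjecture leg (Theorem structure, Step 3 assembled: `∫_{[-½,½]³} ξ^k (½ − ‖ξ‖∞)₊ = ∫₀^{½} cubeInt ρ dρ = intQ · 2^{-K-4}/(…); statement as displayed, box port verbatim. [cite: BuiHall2023, §1 Conjecture 1 — a step of THIS TREE's proof of it (box write-up paper-v3-d979a68f Theorem structure; Step 3 assembled: `∫_{[-½;½]³} ξ^k (½ − ‖ξ‖∞)₊ = ∫₀); the cited paper states the conjecture and the proof is ours] -/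
theorem Kslab_measurable (ρ : ℝ) : Measurable (fun z : ℝ × ℝ × ℝ => Kslab k₁ k₂ k₃ k₄ ρ z.1 z.2.1 z.2.2) := by
  unfold Kslab
  refine Measurable.ite ?_ (monoQ_continuous k₁ k₂ k₃ k₄).measurable measurable_const
  exact measurableSet_le (by fun_prop) measurable_const

/-- Auxiliary lemma `Kslab_abs_le` of the Bui–Hall sign-conjecture leg (Theorem structure, Step 3 assembled: `∫_{[-½,½]³} ξ^k (½ − ‖ξ‖∞)₊ = ∫₀^{½} cubeInt ρ dρ = intQ · 2^{-K-4}/(…); statement as displayed, box port verbatim. [cite: BuiHall2023, §1 Conjecture 1 — a step of THIS TREE's proof of it (box write-up paper-v3-d979a68f Theorem structure; Step 3 assembled: `∫_{[-½;½]³} ξ^k (½ − ‖ξ‖∞)₊ = ∫₀); the cited paper states the conjecture and the proof is ours] -/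
theorem Kslab_abs_le (ρ : ℝ) {a b e : ℝ} (ha : |a| ≤ 1) (hb : |b| ≤ 1) (he : |e| ≤ 1) :
    |Kslab k₁ k₂ k₃ k₄ ρ a b e| ≤ 3 ^ (k₁ + k₂ + k₃ + k₄) := by
  unfold Kslab; split_ifs
  · exact monoQ_abs_le k₁ k₂ k₃ k₄ ha hb he
  · simp

/-- (v), e-level [cite: BuiHall2023, §1 Conjecture 1 — a step of THIS TREE's proof of it (box write-up paper-v3-d979a68f Theorem structure; Step 3 assembled: `∫_{[-½;½]³} ξ^k (½ − ‖ξ‖∞)₊ = ∫₀); the cited paper states the conjecture and the proof is ours] -/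
theorem cut_e {ρ a b : ℝ} (hρ : 0 ≤ ρ) (hρ2 : ρ ≤ 1/2) (ha : |a| ≤ 1) (hb : |b| ≤ 1) :
    ∫ e in (-(1/2 : ℝ))..(1/2), Kten k₁ k₂ k₃ k₄ a b e ρ
      = if (|a| ≤ ρ ∧ |b| ≤ ρ) then ∫ e in (-ρ)..ρ, Kslab k₁ k₂ k₃ k₄ ρ a b e else 0 := by
  by_cases hab : (|a| ≤ ρ ∧ |b| ≤ ρ)
  · rw [if_pos hab]
    have hf : ∀ e, ρ < |e| → Kten k₁ k₂ k₃ k₄ a b e ρ = 0 := by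
      intro e he; unfold Kten; rw [if_neg]; rw [supN_le_iff]; intro h; linarith [h.2.1]
    have hfi : ∀ p q, IntervalIntegrable (fun e => Kten k₁ k₂ k₃ k₄ a b e ρ) volume p q := by
      intro p q
      apply ii_of_bdd_meas' (C := 3 ^ (k₁ + k₂ + k₃ + k₄))
      · exact (Kten_measurable k₁ k₂ k₃ k₄).comp
          ((measurable_const.prodMk (measurable_const.prodMk measurable_id)).prodMk measurable_const)
      · intro e
        by_cases he : |e| ≤ 1
        · exact Kten_abs_le k₁ k₂ k₃ k₄ ha hb he ρ
        · rw [hf e (by push Not at he; linarith)]; simp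
    rw [integral_eq_of_vanish hρ hf hfi (by linarith) (by linarith)]
    apply intervalIntegral.integral_congr; intro e he
    rw [Set.uIcc_of_le (by linarith)] at he
    have he' : |e| ≤ ρ := abs_le.mpr ⟨he.1, he.2⟩
    unfold Kten Kslab
    simp only [supN_le_iff, hab, he', true_and]
  · rw [if_neg hab]
    have e0 : ∀ e ∈ Set.uIcc (-(1/2 : ℝ)) (1/2), Kten k₁ k₂ k₃ k₄ a b e ρ = 0 := by
      intro e _; unfold Kten; rw [if_neg]; rw [supN_le_iff]; exact fun h => hab h.1
    rw [intervalIntegral.integral_congr e0]; simp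

/-- (v), b-level [cite: BuiHall2023, §1 Conjecture 1 — a step of THIS TREE's proof of it (box write-up paper-v3-d979a68f Theorem structure; Step 3 assembled: `∫_{[-½;½]³} ξ^k (½ − ‖ξ‖∞)₊ = ∫₀); the cited paper states the conjecture and the proof is ours] -/
theorem cut_b {ρ a : ℝ} (hρ : 0 ≤ ρ) (hρ2 : ρ ≤ 1/2) (ha : |a| ≤ 1) :
    ∫ b in (-(1/2 : ℝ))..(1/2), (if (|a| ≤ ρ ∧ |b| ≤ ρ) then ∫ e in (-ρ)..ρ, Kslab k₁ k₂ k₃ k₄ ρ a b e else 0)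
      = if |a| ≤ ρ then ∫ b in (-ρ)..ρ, ∫ e in (-ρ)..ρ, Kslab k₁ k₂ k₃ k₄ ρ a b e else 0 := by
  by_cases haρ : |a| ≤ ρ
  · rw [if_pos haρ]
    set g : ℝ → ℝ := fun b => if (|a| ≤ ρ ∧ |b| ≤ ρ) then ∫ e in (-ρ)..ρ, Kslab k₁ k₂ k₃ k₄ ρ a b e else 0 with hg
    have hEm : Measurable fun b => ∫ e in (-ρ)..ρ, Kslab k₁ k₂ k₃ k₄ ρ a b e := by
      have hK : Measurable (fun w : ℝ × ℝ => Kslab k₁ k₂ k₃ k₄ ρ a w.1 w.2) :=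
        (Kslab_measurable k₁ k₂ k₃ k₄ ρ).comp (measurable_const.prodMk (measurable_fst.prodMk measurable_snd))
      have e : (fun b => ∫ e in (-ρ)..ρ, Kslab k₁ k₂ k₃ k₄ ρ a b e)
          = fun b => ∫ e, Kslab k₁ k₂ k₃ k₄ ρ a b e ∂(volume.restrict (Ioc (-ρ) ρ)) := by
        ext b; rw [intervalIntegral.integral_of_le (by linarith)]
      rw [e]; exact (hK.stronglyMeasurable.integral_prod_right').measurable
    have hEb : ∀ b, |b| ≤ 1 → |∫ e in (-ρ)..ρ, Kslab k₁ k₂ k₃ k₄ ρ a b e| ≤ 3 ^ (k₁ + k₂ + k₃ + k₄) := by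
      intro b hb
      have := intervalIntegral.norm_integral_le_of_norm_le_const (a := -ρ) (b := ρ) (C := 3 ^ (k₁ + k₂ + k₃ + k₄))
        (f := fun e => Kslab k₁ k₂ k₃ k₄ ρ a b e) (fun e he => by
          rw [Set.uIoc_of_le (by linarith)] at he
          rw [Real.norm_eq_abs]
          exact Kslab_abs_le k₁ k₂ k₃ k₄ ρ ha hb (abs_le.mpr ⟨by linarith [he.1], by linarith [he.2]⟩))
      rw [Real.norm_eq_abs] at this
      refine this.trans ?_
      have : |ρ - -ρ| ≤ 1 := by rw [abs_le]; constructor <;> linarith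
      have h3 : (0:ℝ) ≤ 3 ^ (k₁ + k₂ + k₃ + k₄) := by positivity
      nlinarith
    have hgm : Measurable g := by
      simp only [hg]
      refine Measurable.ite ?_ hEm measurable_const
      have : {b : ℝ | |a| ≤ ρ ∧ |b| ≤ ρ} = {b : ℝ | |b| ≤ ρ} := by ext b; simp [haρ]
      rw [this]; exact measurableSet_le continuous_abs.measurable measurable_const
    have hgv : ∀ b, ρ < |b| → g b = 0 := by
      intro b hb; simp only [hg]; rw [if_neg]; intro h; linarith [h.2]
    have hgb : ∀ b, |g b| ≤ 3 ^ (k₁ + k₂ + k₃ + k₄) := by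
      intro b; simp only [hg]; split_ifs with h
      · exact hEb b (h.2.trans (by linarith))
      · simp
    have hgi : ∀ p q, IntervalIntegrable g volume p q := fun p q => ii_of_bdd_meas' hgm hgb p q
    change ∫ b in (-(1/2 : ℝ))..(1/2), g b = _
    rw [integral_eq_of_vanish hρ hgv hgi (by linarith) (by linarith)]
    apply intervalIntegral.integral_congr; intro b hb
    rw [Set.uIcc_of_le (by linarith)] at hb
    have hb' : |b| ≤ ρ := abs_le.mpr ⟨hb.1, hb.2⟩
    simp only [hg, haρ, hb', and_self, if_true]
  · rw [if_neg haρ]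
    have e0 : ∀ b ∈ Set.uIcc (-(1/2 : ℝ)) (1/2),
        (if (|a| ≤ ρ ∧ |b| ≤ ρ) then ∫ e in (-ρ)..ρ, Kslab k₁ k₂ k₃ k₄ ρ a b e else 0) = 0 := by
      intro b _; rw [if_neg (fun h => haρ h.1)]
    rw [intervalIntegral.integral_congr e0]; simp

end struct3d

section struct3e
variable (k₁ k₂ k₃ k₄ : ℕ)

/-- (v), a-level [cite: BuiHall2023, §1 Conjecture 1 — a step of THIS TREE's proof of it (box write-up paper-v3-d979a68f Theorem structure; Step 3 assembled: `∫_{[-½;½]³} ξ^k (½ − ‖ξ‖∞)₊ = ∫₀); the cited paper states the conjecture and the proof is ours] -/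
theorem cut_a {ρ : ℝ} (hρ : 0 ≤ ρ) (hρ2 : ρ ≤ 1/2) :
    ∫ a in (-(1/2 : ℝ))..(1/2), (if |a| ≤ ρ then ∫ b in (-ρ)..ρ, ∫ e in (-ρ)..ρ, Kslab k₁ k₂ k₃ k₄ ρ a b e else 0)
      = cubeInt k₁ k₂ k₃ k₄ ρ := by
  set g : ℝ → ℝ := fun a => if |a| ≤ ρ then ∫ b in (-ρ)..ρ, ∫ e in (-ρ)..ρ, Kslab k₁ k₂ k₃ k₄ ρ a b e else 0 with hg
  -- measurability of the double parametric integral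
  have hK : Measurable (fun w : (ℝ × ℝ) × ℝ => Kslab k₁ k₂ k₃ k₄ ρ w.1.1 w.1.2 w.2) :=
    (Kslab_measurable k₁ k₂ k₃ k₄ ρ).comp ((measurable_fst.comp measurable_fst).prodMk
      ((measurable_snd.comp measurable_fst).prodMk measurable_snd))
  have hInner : StronglyMeasurable (fun w : ℝ × ℝ => ∫ e, Kslab k₁ k₂ k₃ k₄ ρ w.1 w.2 e ∂(volume.restrict (Ioc (-ρ) ρ))) :=
    hK.stronglyMeasurable.integral_prod_right'
  have hDm : Measurable fun a => ∫ b in (-ρ)..ρ, ∫ e in (-ρ)..ρ, Kslab k₁ k₂ k₃ k₄ ρ a b e := by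
    have e : (fun a => ∫ b in (-ρ)..ρ, ∫ e in (-ρ)..ρ, Kslab k₁ k₂ k₃ k₄ ρ a b e)
        = fun a => ∫ b, (∫ e, Kslab k₁ k₂ k₃ k₄ ρ a b e ∂(volume.restrict (Ioc (-ρ) ρ))) ∂(volume.restrict (Ioc (-ρ) ρ)) := by
      ext a; rw [intervalIntegral.integral_of_le (by linarith)]
      congr 1; ext b; rw [intervalIntegral.integral_of_le (by linarith)]
    rw [e]; exact (hInner.integral_prod_right').measurable
  have hDb : ∀ a, |a| ≤ 1 → |∫ b in (-ρ)..ρ, ∫ e in (-ρ)..ρ, Kslab k₁ k₂ k₃ k₄ ρ a b e| ≤ 3 ^ (k₁ + k₂ + k₃ + k₄) := by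
    intro a ha
    have h3 : (0:ℝ) ≤ 3 ^ (k₁ + k₂ + k₃ + k₄) := by positivity
    have hlen : |ρ - -ρ| ≤ 1 := by rw [abs_le]; constructor <;> linarith
    have := intervalIntegral.norm_integral_le_of_norm_le_const (a := -ρ) (b := ρ) (C := 3 ^ (k₁ + k₂ + k₃ + k₄))
      (f := fun b => ∫ e in (-ρ)..ρ, Kslab k₁ k₂ k₃ k₄ ρ a b e) (fun b hb => by
        rw [Set.uIoc_of_le (by linarith)] at hb
        have hb1 : |b| ≤ 1 := abs_le.mpr ⟨by linarith [hb.1], by linarith [hb.2]⟩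
        have := intervalIntegral.norm_integral_le_of_norm_le_const (a := -ρ) (b := ρ) (C := 3 ^ (k₁ + k₂ + k₃ + k₄))
          (f := fun e => Kslab k₁ k₂ k₃ k₄ ρ a b e) (fun e he => by
            rw [Set.uIoc_of_le (by linarith)] at he
            rw [Real.norm_eq_abs]
            exact Kslab_abs_le k₁ k₂ k₃ k₄ ρ ha hb1 (abs_le.mpr ⟨by linarith [he.1], by linarith [he.2]⟩))
        rw [Real.norm_eq_abs] at this ⊢
        nlinarith)
    rw [Real.norm_eq_abs] at this
    nlinarith
  have hgm : Measurable g := by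
    simp only [hg]
    exact Measurable.ite (measurableSet_le continuous_abs.measurable measurable_const) hDm measurable_const
  have hgv : ∀ a, ρ < |a| → g a = 0 := by intro a ha; simp only [hg]; rw [if_neg (by linarith)]
  have hgb : ∀ a, |g a| ≤ 3 ^ (k₁ + k₂ + k₃ + k₄) := by
    intro a; simp only [hg]; split_ifs with h
    · exact hDb a (h.trans (by linarith))
    · simp
  have hgi : ∀ p q, IntervalIntegrable g volume p q := fun p q => ii_of_bdd_meas' hgm hgb p q
  change ∫ a in (-(1/2 : ℝ))..(1/2), g a = _
  rw [integral_eq_of_vanish hρ hgv hgi (by linarith) (by linarith)]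
  unfold cubeInt
  apply intervalIntegral.integral_congr; intro a ha
  rw [Set.uIcc_of_le (by linarith)] at ha
  have ha' : |a| ≤ ρ := abs_le.mpr ⟨ha.1, ha.2⟩
  simp only [hg, ha', if_true]
  rfl

/-- **Step 3 of Theorem structure**: `∫_{[-½,½]³} ξ^k (½ − ‖ξ‖∞)₊ dξ = (½)^{K+4}/(K+4) · ∫_Q η^k` [cite: BuiHall2023, §1 Conjecture 1 — a step of THIS TREE's proof of it (box write-up paper-v3-d979a68f Theorem structure; Step 3 assembled: `∫_{[-½;½]³} ξ^k (½ − ‖ξ‖∞)₊ = ∫₀); the cited paper states the conjecture and the proof is ours] -/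
theorem tent_eq_intQ :
    ∫ a in (-(1/2 : ℝ))..(1/2), ∫ b in (-(1/2 : ℝ))..(1/2), ∫ e in (-(1/2 : ℝ))..(1/2),
        monoQ k₁ k₂ k₃ k₄ a b e * max (1/2 - supN a b e) 0
      = (1/2 : ℝ) ^ (k₁ + k₂ + k₃ + k₄ + 4) / ((k₁ + k₂ + k₃ + k₄ : ℕ) + 4)
          * intQ (fun a b e f => a ^ k₁ * b ^ k₂ * e ^ k₃ * f ^ k₄) := by
  -- (i)+(ii)
  have s1 : ∫ a in (-(1/2 : ℝ))..(1/2), ∫ b in (-(1/2 : ℝ))..(1/2), ∫ e in (-(1/2 : ℝ))..(1/2),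
        monoQ k₁ k₂ k₃ k₄ a b e * max (1/2 - supN a b e) 0
      = ∫ a in (-(1/2 : ℝ))..(1/2), ∫ b in (-(1/2 : ℝ))..(1/2), ∫ ρ in (0:ℝ)..(1/2), ∫ e in (-(1/2 : ℝ))..(1/2),
          Kten k₁ k₂ k₃ k₄ a b e ρ := by
    apply intervalIntegral.integral_congr; intro a ha
    apply intervalIntegral.integral_congr; intro b hb
    exact tent_e k₁ k₂ k₃ k₄ a b (abs_le_one_of_mem_uIcc_half ha) (abs_le_one_of_mem_uIcc_half hb)
  rw [s1]
  -- (iii)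
  have s2 : ∫ a in (-(1/2 : ℝ))..(1/2), ∫ b in (-(1/2 : ℝ))..(1/2), ∫ ρ in (0:ℝ)..(1/2), ∫ e in (-(1/2 : ℝ))..(1/2),
        Kten k₁ k₂ k₃ k₄ a b e ρ
      = ∫ a in (-(1/2 : ℝ))..(1/2), ∫ ρ in (0:ℝ)..(1/2), ∫ b in (-(1/2 : ℝ))..(1/2), ∫ e in (-(1/2 : ℝ))..(1/2),
          Kten k₁ k₂ k₃ k₄ a b e ρ := by
    apply intervalIntegral.integral_congr; intro a ha
    exact tent_b k₁ k₂ k₃ k₄ a (abs_le_one_of_mem_uIcc_half ha)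
  rw [s2, tent_a]
  -- (v) per ρ, then Step 3 scaling
  have s3 : ∀ ρ ∈ Set.uIcc (0:ℝ) (1/2), (∫ a in (-(1/2 : ℝ))..(1/2), ∫ b in (-(1/2 : ℝ))..(1/2), ∫ e in (-(1/2 : ℝ))..(1/2),
        Kten k₁ k₂ k₃ k₄ a b e ρ) = ρ ^ (k₁ + k₂ + k₃ + k₄ + 3) * intQ (fun a b e f => a ^ k₁ * b ^ k₂ * e ^ k₃ * f ^ k₄) := by
    intro ρ hρ
    rw [Set.uIcc_of_le (by norm_num)] at hρ
    have c1 : (∫ a in (-(1/2 : ℝ))..(1/2), ∫ b in (-(1/2 : ℝ))..(1/2), ∫ e in (-(1/2 : ℝ))..(1/2), Kten k₁ k₂ k₃ k₄ a b e ρ)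
        = cubeInt k₁ k₂ k₃ k₄ ρ := by
      rw [← cut_a k₁ k₂ k₃ k₄ hρ.1 hρ.2]
      apply intervalIntegral.integral_congr; intro a ha
      simp only
      rw [← cut_b k₁ k₂ k₃ k₄ hρ.1 hρ.2 (abs_le_one_of_mem_uIcc_half ha)]
      apply intervalIntegral.integral_congr; intro b hb
      exact cut_e k₁ k₂ k₃ k₄ hρ.1 hρ.2 (abs_le_one_of_mem_uIcc_half ha) (abs_le_one_of_mem_uIcc_half hb)
    rw [c1]
    rcases eq_or_lt_of_le hρ.1 with h0 | h0
    · rw [← h0]; unfold cubeInt; simp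
    · exact cubeInt_eq k₁ k₂ k₃ k₄ ρ h0
  rw [intervalIntegral.integral_congr s3, intervalIntegral.integral_mul_const, integral_pow]
  push_cast
  ring

end struct3e

/-! ## Theorem structure, Step 2 pieces: (2b) `J` as a window integral over the fixed square, (2e) the `v₁`-fibre (scratch, v3) -/

section struct2b
variable (k l m n : ℕ)

/-- window over the fixed interval `I = [-½,½]`: `∫_I 1[v₁ ≤ s ≤ v₂] f = ∫_{v₁}^{v₂} f` [cite: BuiHall2023, §1 Conjecture 1 — a step of THIS TREE's proof of it (box write-up paper-v3-d979a68f Theorem structure; Step 2 pieces: (2b) `J` as a window integral over t); the cited paper states the conjecture and the proof is ours] -/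
theorem window_I {v₁ v₂ : ℝ} (h1 : -(1/2 : ℝ) ≤ v₁) (h12 : v₁ ≤ v₂) (h2 : v₂ ≤ 1/2) (f : ℝ → ℝ) :
    ∫ s in (-(1/2 : ℝ))..(1/2), (if v₁ ≤ s ∧ s ≤ v₂ then f s else 0) = ∫ s in v₁..v₂, f s := by
  have e : (fun s => if v₁ ≤ s ∧ s ≤ v₂ then f s else 0) = Set.indicator (Icc v₁ v₂) f := by
    ext s; simp only [Set.indicator_apply, mem_Icc]
  rw [e, intervalIntegral.integral_of_le (by norm_num), intervalIntegral.integral_of_le h12,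
    setIntegral_indicator measurableSet_Icc]
  apply setIntegral_congr_set
  have hh : (Ioc (-(1/2 : ℝ)) (1/2) ∩ Icc v₁ v₂ : Set ℝ) =ᵐ[volume] (Icc (-(1/2 : ℝ)) (1/2) ∩ Icc v₁ v₂ : Set ℝ) :=
    (Ioc_ae_eq_Icc (μ := volume)).inter (ae_eq_refl _)
  rw [Set.Icc_inter_Icc, max_eq_right h1, min_eq_right h2] at hh
  exact hh.trans (Ioc_ae_eq_Icc (μ := volume)).symm

/-- (2b): for `v₁ ≤ v₂` in `I`, `J_{k,ℓ}J_{m,n}(v₁,v₂) = ∫_I∫_I 1[v₁≤s≤v₂]1[v₁≤t≤v₂] s^k(σ−s)^ℓ t^m(σ−t)^n` [cite: BuiHall2023, §1 Conjecture 1 — a step of THIS TREE's proof of it (box write-up paper-v3-d979a68f Theorem structure; Step 2 pieces: (2b) `J` as a window integral over t); the cited paper states the conjecture and the proof is ours] -/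
theorem JJ_window {v₁ v₂ : ℝ} (h1 : -(1/2 : ℝ) ≤ v₁) (h12 : v₁ ≤ v₂) (h2 : v₂ ≤ 1/2) :
    Jkl k l v₁ v₂ * Jkl m n v₁ v₂
      = ∫ s in (-(1/2 : ℝ))..(1/2), ∫ t in (-(1/2 : ℝ))..(1/2),
          (if (v₁ ≤ s ∧ s ≤ v₂) ∧ (v₁ ≤ t ∧ t ≤ v₂) then
            s ^ k * (v₁ + v₂ - s) ^ l * (t ^ m * (v₁ + v₂ - t) ^ n) else 0) := by
  unfold Jkl
  rw [← window_I h1 h12 h2, ← window_I h1 h12 h2, ← intervalIntegral.integral_mul_const]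
  apply intervalIntegral.integral_congr; intro s _
  simp only
  rw [← intervalIntegral.integral_const_mul]
  apply intervalIntegral.integral_congr; intro t _
  simp only
  split_ifs with hs ht ht <;> simp_all

end struct2b

section struct2e2

/-- (2e): the `v₁`-fibre of the region: for `s, t ∈ I` the constraints
`v₁ ≤ σ−v₁, |σ−v₁| ≤ ½, v₁ ≤ s ≤ σ−v₁, v₁ ≤ t ≤ σ−v₁` on `v₁ ∈ I` are `max(−½,σ−½) ≤ v₁ ≤ min(min s (σ−s)) (min t (σ−t))`,
and the fibre integral is `(½ − ‖ξ‖∞)₊` with `ξ = (s, σ−s, −t, t−σ)` [cite: BuiHall2023, §1 Conjecture 1 — a step of THIS TREE's proof of it (box write-up paper-v3-d979a68f Theorem structure; Step 2 pieces: (2b) `J` as a window integral over t); the cited paper states the conjecture and the proof is ours] -/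
theorem fibre_v1 {σ s t : ℝ} (hs : |s| ≤ 1/2) (ht : |t| ≤ 1/2) :
    ∫ v in (-(1/2 : ℝ))..(1/2),
        (if (v ≤ σ - v ∧ |σ - v| ≤ 1/2) ∧ ((v ≤ s ∧ s ≤ σ - v) ∧ (v ≤ t ∧ t ≤ σ - v)) then (1:ℝ) else 0)
      = max (1/2 - supN s (σ - s) (-t)) 0 := by
  have hs' := abs_le.mp hs; have ht' := abs_le.mp ht
  set L := max (-(1/2 : ℝ)) (σ - 1/2) with hL
  set U := min (min s (σ - s)) (min t (σ - t)) with hU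
  have e : ∀ v ∈ Set.uIcc (-(1/2 : ℝ)) (1/2),
      (if (v ≤ σ - v ∧ |σ - v| ≤ 1/2) ∧ ((v ≤ s ∧ s ≤ σ - v) ∧ (v ≤ t ∧ t ≤ σ - v)) then (1:ℝ) else 0)
        = (if L ≤ v ∧ v ≤ U then (1:ℝ) else 0) := by
    intro v hv
    rw [Set.uIcc_of_le (by norm_num)] at hv
    have key : ((v ≤ σ - v ∧ |σ - v| ≤ 1/2) ∧ ((v ≤ s ∧ s ≤ σ - v) ∧ (v ≤ t ∧ t ≤ σ - v))) ↔ (L ≤ v ∧ v ≤ U) := by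
      simp only [hL, hU, max_le_iff, le_min_iff, abs_le]
      constructor
      · rintro ⟨⟨h1, h2, h3⟩, ⟨h4, h5⟩, h6, h7⟩
        exact ⟨⟨hv.1, by linarith⟩, ⟨h4, by linarith⟩, h6, by linarith⟩
      · rintro ⟨⟨h1, h2⟩, ⟨h4, h5⟩, h6, h7⟩
        exact ⟨⟨by linarith, by linarith, by linarith⟩, ⟨h4, by linarith⟩, h6, by linarith⟩
    simp only [key]
  rw [intervalIntegral.integral_congr e,
    fibre_integral (le_max_left _ _) ((min_le_left _ _).trans ((min_le_left _ _).trans hs'.2))]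
  congr 1
  have := fibre_len_eq s (σ - s) (-t)
  rw [neg_neg, show s + (σ - s) + -t = σ - t by ring, show s + (σ - s) - 1/2 = σ - 1/2 by ring] at this
  unfold supN
  rw [show s + (σ - s) + -t = σ - t by ring]
  exact this

end struct2e2


/-- Discharge BY NAME of the intermediate Prop `ElevenCore` (box write-up Prop. 6): it is the theorem `elevenCore_holds` of this module. [cite: BuiHall2023, §1 Conjecture 1 — a step of THIS TREE's proof of it (box write-up paper-v3-d979a68f Prop. 6); the cited paper states the conjecture and the proof is ours] -/
theorem ElevenCore_holds : ElevenCore := elevenCore_holds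

/-- Discharge BY NAME of the intermediate Prop `Mixture` (box write-up Section 4.1): it is the theorem `mixture_holds` of this module. [cite: BuiHall2023, §1 Conjecture 1 — a step of THIS TREE's proof of it (box write-up paper-v3-d979a68f Section 4.1); the cited paper states the conjecture and the proof is ours] -/
theorem Mixture_holds : Mixture := mixture_holds

end Literature.NumberTheory.LFunctions.BuiHall
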